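import Literature.NumberTheory.DiophantineGeometry.BelyiMapSignatureTwoThreeThirteen
import Mathlib.FieldTheory.SplittingField.Construction
import HarnessLib

/-!
# A covering of signature `(2, 3, 11)`: three Kummer layers over Klein's resolvent of degree `11`

Topic: `Literature/NumberTheory/DiophantineGeometry`. Theorem-only file (no definition, no named
fact), the sixth of the chain `BelyiMapSignatureTwoThreeEven` (`(2, 3, 2m)`, dihedral seed),
`BelyiMapSignatureTwoThreeTriple` (`(2, 3, 3m)`, tetrahedral seed), `BelyiMapSignatureTwoThreeFive`
(`(2, 3, 5m)`, icosahedral seed), `BelyiMapSignatureTwoThreeSeven` (`(2, 3, 7)`, the `j`-map of `X₁(7)`),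
`BelyiMapSignatureTwoThreeThirteen` (`(2, 3, 13)`, the `j`-map of `X₀(13)`) attached to the named fact
`AbcWave0.darmonGranville1995_thm_2` and to Pasten's Lemma 6.10
(`Literature.NumberTheory.EllipticCurves.PastenShimura2024_lemma_6_10`). It constructs EXPLICITLY, in
the tree's function-field language and in exactly the shape consumed by
`finite_properSolutions_of_belyiMap_of_faltings` (`AbcDarmonGranvilleSignatureReduction`), a covering of
`ℙ¹` of signature `(2, 3, 11)` over a number field
(`AlgFunctionField.exists_belyiMap_signature_two_three_eleven`), whence Darmon–Granville's Theorem 2 for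
every signature `(p, q, r)` with `2 ∣ p`, `3 ∣ q`, `11 ∣ r` — in particular `(r, 2, 3)` for every `r`
divisible by `11` — modulo Faltings' theorem ONLY
(`finite_properSolutions_signature_two_three_eleven_of_faltings`,
`finite_properSolutions_signature_eleven_two_three_of_faltings`), and, with the five companions, for
every `r ≥ 7` having a prime factor `≤ 13`
(`finite_properSolutions_signature_r_two_three_of_faltings_of_dvd_le_thirteen`). No Riemann existence
theorem is used.

Why this goes beyond the companions, and why the chain stops here. `Δ(2, 3, 11)` is perfect, so a
covering of signature `(2, 3, 11)` needs a non-solvable seed; `X(11)` has the quotient `X(11)/A₅` of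
genus `0` and degree `11` over the `J`-line (`PSL₂(𝔽₁₁)` has the exceptional subgroup `A₅` of index `11`:
Galois 1832, Klein 1879), in two conjugate copies defined over `ℚ(√-11)`. For a prime `p ≥ 17` no
congruence quotient of `X(p)` of genus `0` other than `X(1)` is available (the genus-`0` congruence
subgroups have levels whose prime factors are `≤ 13`, Cummins–Pauli), so no covering of signature
`(2, 3, p)` is obtained from a rational modular seed and Kummer layers: the primes `≤ 13` are the reach of
this method, and the remaining signatures are left to the Riemann existence theorem
(`exists_signatureCover_numberField`).

## The construction

Klein's resolvent of degree `11` in Klein–Fricke's second shape (Fricke, *Elliptische Funktionen* II,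
II.5 §7 "Die beiden Resolventen elften Grades", eq. (15), p. 490; Klein, Math. Ann. 15 (1879)): with
`s = i√11`,
`J : J - 1 : 1 = D C³ : B A² : 12³`,
`D = ξ² + 3ξ + (5 - s)`, `C = ξ³ - ξ² - 3(1 + s)/2 · ξ - (7 - s)/2`,
`B = ξ³ - 4ξ² + (7 - 5s)/2 · ξ - (4 - 6s)`, `A = ξ⁴ + 2ξ³ + 3(1 - s)/2 · ξ² - (5 + s)ξ - 3(5 + s)/2`.
With the integral forms `𝔄 = 2A`, `𝔅 = 2B`, `ℭ = 2C`, `𝔇 = D` (local notations with the parameter `s`)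
this is the identity **`𝔇 ℭ³ - 13824 = 𝔅 𝔄²`** in `K[X]` for `s² = -11` (`formsE_identity`, by
`linear_combination` with an explicit cofactor of `(C s)² + 11`), i.e. a Shabat polynomial of degree
`11` with passport `[11; 2⁴ 1³; 3³ 1²]`. The seed on the line `K(v)` is
`𝔤 = -𝔅(v) 𝔄(v)²/13824 = 1 - J(v)`, `𝔤 - 1 = -𝔇(v) ℭ(v)³/13824`,
with zeros of order `2` (at `𝔄(v) = 0`) and `1` (at the three roots `bᵢ` of `𝔅`), zeros of `𝔤 - 1`
of order `3` (at `ℭ(v) = 0`) and `1` (at the two roots `dⱼ` of `𝔇`), one pole `v = ∞` of order `11`,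
and unramified over every other closed point of the `𝔤`-line (`seedE_zeros`, `seedE_ones`, `seedE_poles`,
`seedE_elsewhere` — the last by the even companion's `pullback_separable` with `A = -𝔅 𝔄²`,
`B = 13824`, `A - B = -𝔇 ℭ³`, Wronskian `-13824 · 11 · 𝔄 ℭ²`). The polynomial algebra is: the two
**Wronskian identities** `2 𝔄' 𝔅 + 𝔄 𝔅' = 11 ℭ²`, `3 ℭ' 𝔇 + ℭ 𝔇' = 11 𝔄` (`P' = 11 A C²` for the
Shabat polynomial; `wronskianE₁`, `wronskianE₂`, by `linear_combination` modulo `s² = -11`), the unit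
`𝔇 ℭ³ - 𝔅 𝔄² = 13824` (`isCoprime_sidesE`), whence the pairwise coprimality and the separability of
`𝔄, 𝔅, ℭ, 𝔇` (`isCoprime_acrossE`, `isCoprime_withinE`, `separable_formsE`).

The five simple points are then uniformised by THREE Kummer layers of prime degrees whose radicands all
live on the line (so that only the two extreme cases `q ∣ v(h)` / `gcd(q, v(h)) = 1` of Stichtenoth
Prop. 3.7.3 occur, `PlaceOver.exists_index_of_pow_eq`): over a number field `K ∋ s` over which `𝔅` and
`𝔇` split, `𝔅 = c ∏ (X - bᵢ)`, `𝔇 = c' (X - d₁)(X - d₂)`,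
* `F₁ = K(v)(g₁)`, `g₁³ = (v - d₁)(v - d₂)²` — index `3` above `d₁, d₂`, unramified elsewhere
  (`v_∞ = -3`) (`layer1E_zeros`, `…_ones`, `…_poles`, `…_elsewhere`);
* `F₂ = F₁(g₂)`, `g₂² = (v - b₁)(v - b₂)` — index `2` above `b₁, b₂` (`layer2E_…`);
* `F₃ = F₂(g₃)`, `g₃² = (v - b₁)(v - b₃)` — index `2` above `b₃`, and UNRAMIFIED above `b₁` where its
  radicand has acquired the even order `2` (the Klein four group `V₄` on the three points `bᵢ`: every
  `bᵢ` gets total index exactly `2`; a single cyclic layer cannot do this, three branch points being odd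
  in number);
so that `𝔤 ∈ F₃` has zeros of order `2`, `𝔤 - 1` zeros of order `3`, poles of order `11`, and `F₃/K(𝔤)`
is unramified over the other closed points: a covering of degree `132 = 11 · 12` and genus `6`
(`1 + 132 · (1 - 1/2 - 1/3 - 1/11)/2`; the degree and genus of `X(11)/C₅ → X(1)`)
(`exists_belyiMap_signature_two_three_eleven_aux`);
finally `K` is replaced by the full constant field of `F₃` (`exists_fullConstantField_of_signature`).
The number field is the splitting field over `ℚ` of `(X² + 11) · N(𝔅) · N(𝔇)`,
`N(𝔅) = 𝔅 𝔅̄ = 4X⁶ - 32X⁵ + 92X⁴ - 144X³ + 452X² - 1432X + 1648`,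
`N(𝔇) = 𝔇 𝔇̄ = X⁴ + 6X³ + 19X² + 30X + 36` (`formsE_norm`; Mathlib's `Polynomial.SplittingField`, a
number field), in which `s`, the `bᵢ` and the `dⱼ` are read off the root multisets
(`exists_belyiMap_signature_two_three_eleven`).

Implementation note: as in the companions the forms are local notations with fully ascribed leaves; all
identities involving `s` are `linear_combination e * C_sq_eq s hs` with explicit cofactors `e`.

## References

* F. Klein, *Ueber die Transformation elfter Ordnung der elliptischen Functionen*, Math. Ann. 15 (1879)
  533–555 (the resolvents of degree `11`, `X(11)/A₅ → X(1)`). [Klein1879Elf]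
* R. Fricke, *Die elliptischen Funktionen und ihre Anwendungen. Zweiter Teil: Die algebraischen
  Ausführungen*, Teubner 1922 (reprint Springer 2012): II.5 §7 "Die beiden Resolventen elften Grades",
  pp. 486–491, eq. (15) p. 490. [FrickeElliptische2]
* H. Darmon, A. Granville, *On the equations `z^m = F(x, y)` and `A x^p + B y^q = C z^r`*, Bull. London
  Math. Soc. 27 (1995) 513–543: Theorem 2 (p. 515), Prop. 3.1 (p. 525). [DarmonGranville1995]
* H. Stichtenoth, *Algebraic Function Fields and Codes*, GTM 254, 2009: Prop. 3.7.3 (Kummer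
  extensions), Thm. 3.1.11, Prop. 1.1.5, Cor. 1.1.20. [Stichtenoth2009]
* H. Pasten, *Shimura curves and the abc conjecture*, J. Number Theory 254 (2024) 214–335
  (arXiv:1705.09251), §6.5, Lemma 6.10. [PastenShimura2024]
-/

noncomputable section

open scoped Classical Polynomial IntermediateField

namespace Literature.NumberTheory.DiophantineGeometry

open Polynomial

universe u v

namespace AlgFunctionField

/-! ### A. Klein's level-`11` forms over `ℚ(√-11)` (Klein–Fricke's second shape of the resolvent) -/

/-- `𝔄 = 2 A`, `A = ξ⁴ + 2ξ³ + 3(1 - s)/2 ξ² - (5 + s) ξ - 3(5 + s)/2` (the four double points over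
`J = 1`; `s = i√11`; local notation). -/
local notation3 "𝔄(" K ", " s ")" =>
  ((2 : Polynomial K) * (X : Polynomial K) ^ (4 : ℕ) + (4 : Polynomial K) * (X : Polynomial K) ^ (3 : ℕ) +
    ((3 : Polynomial K) - (3 : Polynomial K) * Polynomial.C s) * (X : Polynomial K) ^ (2 : ℕ) -
    ((10 : Polynomial K) + (2 : Polynomial K) * Polynomial.C s) * (X : Polynomial K) -
    ((15 : Polynomial K) + (3 : Polynomial K) * Polynomial.C s))

/-- `𝔅 = 2 B`, `B = ξ³ - 4ξ² + (7 - 5s)/2 ξ - (4 - 6s)` (the three simple points over `J = 1`; local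
notation). -/
local notation3 "𝔅(" K ", " s ")" =>
  ((2 : Polynomial K) * (X : Polynomial K) ^ (3 : ℕ) - (8 : Polynomial K) * (X : Polynomial K) ^ (2 : ℕ) +
    ((7 : Polynomial K) - (5 : Polynomial K) * Polynomial.C s) * (X : Polynomial K) -
    ((8 : Polynomial K) - (12 : Polynomial K) * Polynomial.C s))

/-- `ℭ = 2 C`, `C = ξ³ - ξ² - 3(1 + s)/2 ξ - (7 - s)/2` (the three triple points over `J = 0`; local
notation). -/
local notation3 "ℭ(" K ", " s ")" =>
  ((2 : Polynomial K) * (X : Polynomial K) ^ (3 : ℕ) - (2 : Polynomial K) * (X : Polynomial K) ^ (2 : ℕ) -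
    ((3 : Polynomial K) + (3 : Polynomial K) * Polynomial.C s) * (X : Polynomial K) -
    ((7 : Polynomial K) - Polynomial.C s))

/-- `𝔇 = ξ² + 3ξ + (5 - s)` (the two simple points over `J = 0`; local notation). -/
local notation3 "𝔇(" K ", " s ")" =>
  ((X : Polynomial K) ^ (2 : ℕ) + (3 : Polynomial K) * (X : Polynomial K) + ((5 : Polynomial K) - Polynomial.C s))

section Forms

variable {K : Type u} [Field K]

/-- `(C s)² = -11` in `K[X]` when `s² = -11`. [folklore] -/
theorem C_sq_eq (s : K) (hs : s ^ 2 = -11) : (C s : K[X]) ^ 2 = -11 := by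
  rw [← map_pow, hs, map_neg, map_ofNat]

/-- **Klein's level-`11` identity** (Klein 1879; Klein–Fricke, *Elliptische Funktionen* II, p. 490
(15)): `𝔇 ℭ³ - 13824 = 𝔅 𝔄²`, i.e. `J : J - 1 : 1 = D C³ : B A² : 1728` with `𝔄 = 2A`, `𝔅 = 2B`,
`ℭ = 2C`, `𝔇 = D`, for `s² = -11`. [cite: Klein1879Elf, §7 (15)] -/
theorem formsE_identity {s : K} (hs : s ^ 2 = -11) :
    𝔇(K, s) * ℭ(K, s) ^ 3 - 13824 = 𝔅(K, s) * 𝔄(K, s) ^ 2 := by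
  linear_combination ((12 : K[X]) * X ^ 7 + (20 : K[X]) * X ^ 6 - (36 : K[X]) * C s * X ^ 5 +
    (56 : K[X]) * X ^ 5 - (12 : K[X]) * C s * X ^ 4 - (16 : K[X]) * X ^ 4 + (27 : K[X]) * C s ^ 2 * X ^ 3 -
    (58 : K[X]) * C s * X ^ 3 - (125 : K[X]) * X ^ 3 - (27 : K[X]) * C s ^ 2 * X ^ 2 +
    (46 : K[X]) * C s * X ^ 2 - (391 : K[X]) * X ^ 2 + (9 : K[X]) * C s ^ 2 * X - (258 : K[X]) * C s * X -
    (219 : K[X]) * X - (1 : K[X]) * C s ^ 2 - (82 : K[X]) * C s - (1249 : K[X])) * C_sq_eq s hs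

/-- The derivative of `𝔄`. [folklore] -/
theorem derivative_formA (s : K) : derivative 𝔄(K, s) =
    (8 : K[X]) * X ^ 3 + (12 : K[X]) * X ^ 2 - (6 : K[X]) * C s * X + (6 : K[X]) * X - (2 : K[X]) * C s -
      (10 : K[X]) := by
  simp only [derivative_sub, derivative_add, derivative_mul, derivative_X_pow, derivative_X,
    derivative_C, derivative_ofNat, Nat.cast_ofNat, zero_mul, mul_zero, zero_add, add_zero, sub_zero,
    map_ofNat, mul_one]
  ring

/-- The derivative of `𝔅`. [folklore] -/
theorem derivative_formB (s : K) : derivative 𝔅(K, s) =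
    (6 : K[X]) * X ^ 2 - (16 : K[X]) * X - (5 : K[X]) * C s + (7 : K[X]) := by
  simp only [derivative_sub, derivative_add, derivative_mul, derivative_X_pow, derivative_X,
    derivative_C, derivative_ofNat, Nat.cast_ofNat, zero_mul, mul_zero, zero_add, add_zero, sub_zero,
    map_ofNat, mul_one]
  ring

/-- The derivative of `ℭ`. [folklore] -/
theorem derivative_formC (s : K) : derivative ℭ(K, s) =
    (6 : K[X]) * X ^ 2 - (4 : K[X]) * X - (3 : K[X]) * C s - (3 : K[X]) := by
  simp only [derivative_sub, derivative_add, derivative_mul, derivative_X_pow, derivative_X,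
    derivative_C, derivative_ofNat, Nat.cast_ofNat, zero_mul, mul_zero, zero_add, add_zero, sub_zero,
    map_ofNat, mul_one]
  ring

/-- The derivative of `𝔇`. [folklore] -/
theorem derivative_formD (s : K) : derivative 𝔇(K, s) = (2 : K[X]) * X + (3 : K[X]) := by
  simp only [derivative_sub, derivative_add, derivative_mul, derivative_X_pow, derivative_X,
    derivative_C, derivative_ofNat, Nat.cast_ofNat, zero_mul, zero_add, add_zero, sub_zero,
    map_ofNat, mul_one]
  ring

/-- **First Wronskian identity** `2 𝔄' 𝔅 + 𝔄 𝔅' = 11 ℭ²` (`(𝔅 𝔄²)' = 11 𝔄 ℭ²`: the derivative of `J`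
vanishes doubly at the triple points over `J = 0`). [folklore] -/
theorem wronskianE₁ {s : K} (hs : s ^ 2 = -11) :
    2 * derivative 𝔄(K, s) * 𝔅(K, s) + 𝔄(K, s) * derivative 𝔅(K, s) = 11 * ℭ(K, s) ^ 2 := by
  rw [derivative_formA, derivative_formB]
  linear_combination (-(24 : K[X]) * X ^ 2 - (48 : K[X]) * X - (44 : K[X])) * C_sq_eq s hs

/-- **Second Wronskian identity** `3 ℭ' 𝔇 + ℭ 𝔇' = 11 𝔄` (`(𝔇 ℭ³)' = 11 𝔄 ℭ²`). [folklore] -/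
theorem wronskianE₂ {s : K} (hs : s ^ 2 = -11) :
    3 * derivative ℭ(K, s) * 𝔇(K, s) + ℭ(K, s) * derivative 𝔇(K, s) = 11 * 𝔄(K, s) := by
  rw [derivative_formC, derivative_formD]
  linear_combination (9 : K[X]) * C_sq_eq s hs

/-- `(𝔅 𝔄²)' = 11 𝔄 ℭ²` (`P' = 11 A C²` for the Shabat polynomial `P = D C³ = B A² + 1728`). [folklore] -/
theorem derivative_formBA {s : K} (hs : s ^ 2 = -11) :
    derivative (𝔅(K, s) * 𝔄(K, s) ^ 2) = 11 * 𝔄(K, s) * ℭ(K, s) ^ 2 := by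
  rw [derivative_mul, derivative_pow, derivative_formA, derivative_formB]
  simp only [Nat.cast_ofNat, map_ofNat, Nat.add_one_sub_one]
  linear_combination (-(48 : K[X]) * X ^ 6 - (192 : K[X]) * X ^ 5 + (72 : K[X]) * C s * X ^ 4 -
    (352 : K[X]) * X ^ 4 + (192 : K[X]) * C s * X ^ 3 - (80 : K[X]) * X ^ 3 + (300 : K[X]) * C s * X ^ 2 +
    (708 : K[X]) * X ^ 2 + (232 : K[X]) * C s * X + (1160 : K[X]) * X + (132 : K[X]) * C s +
    (660 : K[X])) * C_sq_eq s hs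

variable [CharZero K]

/-- `deg 𝔄 = 4`, `deg 𝔅 = 3`, `deg ℭ = 3`, `deg 𝔇 = 2`. [folklore] -/
theorem natDegree_formsE (s : K) : (𝔄(K, s)).natDegree = 4 ∧ (𝔅(K, s)).natDegree = 3 ∧
    (ℭ(K, s)).natDegree = 3 ∧ (𝔇(K, s)).natDegree = 2 := by
  refine ⟨?_, ?_, ?_, ?_⟩ <;> compute_degree!

/-- `𝔄, 𝔅, ℭ, 𝔇 ≠ 0`. [folklore] -/
theorem formsE_ne_zero (s : K) : 𝔄(K, s) ≠ 0 ∧ 𝔅(K, s) ≠ 0 ∧ ℭ(K, s) ≠ 0 ∧ 𝔇(K, s) ≠ 0 := by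
  obtain ⟨hA, hB, hC, hD⟩ := natDegree_formsE (K := K) s
  refine ⟨fun h => ?_, fun h => ?_, fun h => ?_, fun h => ?_⟩
  · rw [h, natDegree_zero] at hA; exact absurd hA (by norm_num)
  · rw [h, natDegree_zero] at hB; exact absurd hB (by norm_num)
  · rw [h, natDegree_zero] at hC; exact absurd hC (by norm_num)
  · rw [h, natDegree_zero] at hD; exact absurd hD (by norm_num)

/-- A non-zero natural number is a unit constant in `K[X]` (`char K = 0`). [folklore] -/
private theorem isUnit_C_ofNat'' {n : ℕ} (hn : n ≠ 0) : IsUnit (C (n : K) : K[X]) :=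
  isUnit_C.mpr (Nat.cast_ne_zero.mpr hn).isUnit

/-- **The two sides are coprime**: `𝔇 ℭ³ - 𝔅 𝔄² = 13824` is a unit. [folklore] -/
theorem isCoprime_sidesE {s : K} (hs : s ^ 2 = -11) :
    IsCoprime (𝔅(K, s) * 𝔄(K, s) ^ 2) (𝔇(K, s) * ℭ(K, s) ^ 3) := by
  have key : (-1 : K[X]) * (𝔅(K, s) * 𝔄(K, s) ^ 2) + 1 * (𝔇(K, s) * ℭ(K, s) ^ 3) = C ((13824 : ℕ) : K) := by
    rw [Nat.cast_ofNat, map_ofNat]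
    linear_combination formsE_identity hs
  obtain ⟨i, hi⟩ := isUnit_C_ofNat'' (K := K) (n := 13824) (by norm_num)
  refine ⟨(↑i⁻¹ : K[X]) * (-1), (↑i⁻¹ : K[X]) * 1, ?_⟩
  rw [mul_assoc, mul_assoc, ← mul_add, key, ← hi, Units.inv_mul]

/-- Pairwise coprimality across the two sides: `𝔄 ⊥ ℭ`, `𝔄 ⊥ 𝔇`, `𝔅 ⊥ ℭ`, `𝔅 ⊥ 𝔇`. [folklore] -/
theorem isCoprime_acrossE {s : K} (hs : s ^ 2 = -11) :
    IsCoprime 𝔄(K, s) ℭ(K, s) ∧ IsCoprime 𝔄(K, s) 𝔇(K, s) ∧ IsCoprime 𝔅(K, s) ℭ(K, s) ∧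
      IsCoprime 𝔅(K, s) 𝔇(K, s) := by
  have h := isCoprime_sidesE (K := K) hs
  have hA : IsCoprime 𝔄(K, s) (𝔇(K, s) * ℭ(K, s) ^ 3) :=
    (IsCoprime.pow_left_iff (by norm_num : 0 < 2)).1 h.of_mul_left_right
  have hB : IsCoprime 𝔅(K, s) (𝔇(K, s) * ℭ(K, s) ^ 3) := h.of_mul_left_left
  exact ⟨(IsCoprime.pow_right_iff (by norm_num : 0 < 3)).1 hA.of_mul_right_right, hA.of_mul_right_left,
    (IsCoprime.pow_right_iff (by norm_num : 0 < 3)).1 hB.of_mul_right_right, hB.of_mul_right_left⟩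

/-- **`𝔄 ⊥ 𝔅` and `ℭ ⊥ 𝔇`**: a common factor of `𝔄` and `𝔅` divides `11 ℭ² = 2 𝔄' 𝔅 + 𝔄 𝔅'`, one of
`ℭ` and `𝔇` divides `11 𝔄 = 3 ℭ' 𝔇 + ℭ 𝔇'`. [folklore] -/
theorem isCoprime_withinE {s : K} (hs : s ^ 2 = -11) :
    IsCoprime 𝔄(K, s) 𝔅(K, s) ∧ IsCoprime ℭ(K, s) 𝔇(K, s) := by
  obtain ⟨hA0, hB0, hC0, hD0⟩ := formsE_ne_zero (K := K) s
  obtain ⟨hAC, -, -, -⟩ := isCoprime_acrossE (K := K) hs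
  have h11 : IsUnit (C ((11 : ℕ) : K) : K[X]) := isUnit_C_ofNat'' (K := K) (by norm_num)
  constructor
  · refine isCoprime_of_irreducible_dvd (fun h => hA0 h.1) fun ρ hρ h1 h2 => ?_
    have hp := hρ.prime
    have h5 : ρ ∣ C ((11 : ℕ) : K) * ℭ(K, s) ^ 2 := by
      have e : C ((11 : ℕ) : K) * ℭ(K, s) ^ 2 =
          2 * derivative 𝔄(K, s) * 𝔅(K, s) + 𝔄(K, s) * derivative 𝔅(K, s) := by
        rw [wronskianE₁ hs]; simp only [Nat.cast_ofNat, map_ofNat]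
      rw [e]
      exact dvd_add (dvd_mul_of_dvd_right h2 _) (dvd_mul_of_dvd_left h1 _)
    rcases hp.dvd_or_dvd h5 with h | h
    · exact hρ.not_isUnit (isUnit_of_dvd_unit h h11)
    · exact hρ.not_isUnit (hAC.isUnit_of_dvd' h1 (hp.dvd_of_dvd_pow h))
  · refine isCoprime_of_irreducible_dvd (fun h => hC0 h.1) fun ρ hρ h1 h2 => ?_
    have hp := hρ.prime
    have h5 : ρ ∣ C ((11 : ℕ) : K) * 𝔄(K, s) := by
      have e : C ((11 : ℕ) : K) * 𝔄(K, s) =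
          3 * derivative ℭ(K, s) * 𝔇(K, s) + ℭ(K, s) * derivative 𝔇(K, s) := by
        rw [wronskianE₂ hs]; simp only [Nat.cast_ofNat, map_ofNat]
      rw [e]
      exact dvd_add (dvd_mul_of_dvd_right h2 _) (dvd_mul_of_dvd_left h1 _)
    rcases hp.dvd_or_dvd h5 with h | h
    · exact hρ.not_isUnit (isUnit_of_dvd_unit h h11)
    · exact hρ.not_isUnit (hAC.isUnit_of_dvd' h h1)

/-- **`𝔄`, `𝔅`, `ℭ`, `𝔇` are separable** (a repeated factor of `𝔄` or of `𝔅` would divide `11 ℭ²`, one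
of `ℭ` or of `𝔇` would divide `11 𝔄`). [folklore] -/
theorem separable_formsE {s : K} (hs : s ^ 2 = -11) :
    (𝔄(K, s)).Separable ∧ (𝔅(K, s)).Separable ∧ (ℭ(K, s)).Separable ∧ (𝔇(K, s)).Separable := by
  obtain ⟨hA0, hB0, hC0, hD0⟩ := formsE_ne_zero (K := K) s
  obtain ⟨hAC, hAD, hBC, -⟩ := isCoprime_acrossE (K := K) hs
  have h11 : IsUnit (C ((11 : ℕ) : K) : K[X]) := isUnit_C_ofNat'' (K := K) (by norm_num)
  have eW₁ : C ((11 : ℕ) : K) * ℭ(K, s) ^ 2 =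
      2 * derivative 𝔄(K, s) * 𝔅(K, s) + 𝔄(K, s) * derivative 𝔅(K, s) := by
    rw [wronskianE₁ hs]; simp only [Nat.cast_ofNat, map_ofNat]
  have eW₂ : C ((11 : ℕ) : K) * 𝔄(K, s) =
      3 * derivative ℭ(K, s) * 𝔇(K, s) + ℭ(K, s) * derivative 𝔇(K, s) := by
    rw [wronskianE₂ hs]; simp only [Nat.cast_ofNat, map_ofNat]
  refine ⟨?_, ?_, ?_, ?_⟩
  · rw [separable_def]
    refine isCoprime_of_irreducible_dvd (fun h => hA0 h.1) fun ρ hρ h1 h2 => ?_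
    have hp := hρ.prime
    have h5 : ρ ∣ C ((11 : ℕ) : K) * ℭ(K, s) ^ 2 := by
      rw [eW₁]
      exact dvd_add (dvd_mul_of_dvd_left (dvd_mul_of_dvd_right h2 _) _) (dvd_mul_of_dvd_left h1 _)
    rcases hp.dvd_or_dvd h5 with h | h
    · exact hρ.not_isUnit (isUnit_of_dvd_unit h h11)
    · exact hρ.not_isUnit (hAC.isUnit_of_dvd' h1 (hp.dvd_of_dvd_pow h))
  · rw [separable_def]
    refine isCoprime_of_irreducible_dvd (fun h => hB0 h.1) fun ρ hρ h1 h2 => ?_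
    have hp := hρ.prime
    have h5 : ρ ∣ C ((11 : ℕ) : K) * ℭ(K, s) ^ 2 := by
      rw [eW₁]
      exact dvd_add (dvd_mul_of_dvd_right h1 _) (dvd_mul_of_dvd_right h2 _)
    rcases hp.dvd_or_dvd h5 with h | h
    · exact hρ.not_isUnit (isUnit_of_dvd_unit h h11)
    · exact hρ.not_isUnit (hBC.isUnit_of_dvd' h1 (hp.dvd_of_dvd_pow h))
  · rw [separable_def]
    refine isCoprime_of_irreducible_dvd (fun h => hC0 h.1) fun ρ hρ h1 h2 => ?_
    have hp := hρ.prime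
    have h5 : ρ ∣ C ((11 : ℕ) : K) * 𝔄(K, s) := by
      rw [eW₂]
      exact dvd_add (dvd_mul_of_dvd_left (dvd_mul_of_dvd_right h2 _) _) (dvd_mul_of_dvd_left h1 _)
    rcases hp.dvd_or_dvd h5 with h | h
    · exact hρ.not_isUnit (isUnit_of_dvd_unit h h11)
    · exact hρ.not_isUnit (hAC.isUnit_of_dvd' h h1)
  · rw [separable_def]
    refine isCoprime_of_irreducible_dvd (fun h => hD0 h.1) fun ρ hρ h1 h2 => ?_
    have hp := hρ.prime
    have h5 : ρ ∣ C ((11 : ℕ) : K) * 𝔄(K, s) := by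
      rw [eW₂]
      exact dvd_add (dvd_mul_of_dvd_right h1 _) (dvd_mul_of_dvd_right h2 _)
    rcases hp.dvd_or_dvd h5 with h | h
    · exact hρ.not_isUnit (isUnit_of_dvd_unit h h11)
    · exact hρ.not_isUnit (hAD.isUnit_of_dvd' h h1)

omit [CharZero K] in
/-- **The Wronskian of `A = -𝔅 𝔄²` and `B = 13824`**: `A' B - A B' = -(13824 · 11) 𝔄 ℭ²`. [folklore] -/
theorem wronskianE {s : K} (hs : s ^ 2 = -11) :
    derivative (-(𝔅(K, s) * 𝔄(K, s) ^ 2)) * C (13824 : K) - -(𝔅(K, s) * 𝔄(K, s) ^ 2) * derivative (C (13824 : K)) =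
      -(C (13824 : K) * C ((11 : ℕ) : K)) * 𝔄(K, s) * ℭ(K, s) ^ 2 := by
  rw [derivative_neg, derivative_formBA hs, derivative_C]
  simp only [Nat.cast_ofNat, map_ofNat]
  ring

end Forms

/-! ### B. The seed `𝔤 = -𝔅(v) 𝔄(v)²/13824 = 1 - J` on the line `K(v) = K(X(11)/A₅)` -/

/-- `𝔄(v)`, `𝔅(v)`, `ℭ(v)`, `𝔇(v)` on the line `K(v)` (local notations). -/
local notation3 "𝔄ᵥ(" K ", " s ")" => (aeval (RatFunc.X : RatFunc K) 𝔄(K, s))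
local notation3 "𝔅ᵥ(" K ", " s ")" => (aeval (RatFunc.X : RatFunc K) 𝔅(K, s))
local notation3 "ℭᵥ(" K ", " s ")" => (aeval (RatFunc.X : RatFunc K) ℭ(K, s))
local notation3 "𝔇ᵥ(" K ", " s ")" => (aeval (RatFunc.X : RatFunc K) 𝔇(K, s))

/-- The seed `𝔤 = -𝔅(v) 𝔄(v)²/13824 = 1 - J(v)`, Klein's resolvent of degree `11` normalised to
`0 ↦ (2, 1)`, `1 ↦ (3, 1)`, `∞ ↦ (11)` (local notation). -/
local notation3 "𝔤(" K ", " s ")" =>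
  (-(𝔅ᵥ(K, s) * 𝔄ᵥ(K, s) ^ (2 : ℕ)) / algebraMap K (RatFunc K) (13824 : K) : RatFunc K)

/-- The linear function `v - a` on the line (local notation). -/
local notation3 "𝔩(" K ", " a ")" => (aeval (RatFunc.X : RatFunc K) ((X : Polynomial K) - Polynomial.C a))

/-- The radicand `𝔥₁ = (v - d₁)(v - d₂)²` of the cubic Kummer layer (local notation). -/
local notation3 "𝔥₁(" K ", " a ", " b ")" =>
  (aeval (RatFunc.X : RatFunc K) (((X : Polynomial K) - Polynomial.C a) * ((X : Polynomial K) - Polynomial.C b) ^ (2 : ℕ)))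

/-- The radicands `𝔥₂ = (v - b₁)(v - b₂)`, `𝔥₃ = (v - b₁)(v - b₃)` of the two quadratic Kummer layers
(local notation). -/
local notation3 "𝔥₂(" K ", " a ", " b ")" =>
  (aeval (RatFunc.X : RatFunc K) (((X : Polynomial K) - Polynomial.C a) * ((X : Polynomial K) - Polynomial.C b)))

section Seed

variable {K : Type u} [Field K]

omit [Field K] in
/-- `a + b + c + 2 d > 0` with one summand positive forces the others (all `≥ 0`, pairwise not both
positive) to vanish — bookkeeping kept outside the big case analysis. [folklore] -/
private theorem aux_four {a b c d : ℤ} (ha : 0 ≤ a) (hb : 0 ≤ b) (hc : 0 ≤ c) (hd : 0 ≤ d)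
    (h : 0 < a + b + c + 2 * d) (hab : ¬ (0 < a ∧ 0 < b)) (hac : ¬ (0 < a ∧ 0 < c)) (hbc : ¬ (0 < b ∧ 0 < c))
    (had : ¬ (0 < d ∧ 0 < a)) (hbd : ¬ (0 < d ∧ 0 < b)) (hcd : ¬ (0 < d ∧ 0 < c)) :
    (0 < d ∧ a = 0 ∧ b = 0 ∧ c = 0) ∨ (d = 0 ∧ 0 < a ∧ b = 0 ∧ c = 0) ∨ (d = 0 ∧ a = 0 ∧ 0 < b ∧ c = 0) ∨
      (d = 0 ∧ a = 0 ∧ b = 0 ∧ 0 < c) := by omega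

omit [Field K] in
/-- `a + 2 b + 3 c > 0` with one summand positive forces the others to vanish. [folklore] -/
private theorem aux_three {a b c : ℤ} (ha : 0 ≤ a) (hb : 0 ≤ b) (hc : 0 ≤ c)
    (h : 0 < a + b + 3 * c) (hab : ¬ (0 < a ∧ 0 < b)) (hca : ¬ (0 < c ∧ 0 < a)) (hcb : ¬ (0 < c ∧ 0 < b)) :
    (0 < c ∧ a = 0 ∧ b = 0) ∨ (c = 0 ∧ 0 < a ∧ b = 0) ∨ (c = 0 ∧ a = 0 ∧ 0 < b) := by omega

/-- The linear functions and the radicands are non-zero on the line. [folklore] -/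
theorem lineE_ne_zero (a b : K) : 𝔩(K, a) ≠ 0 ∧ 𝔥₁(K, a, b) ≠ 0 ∧ 𝔥₂(K, a, b) ≠ 0 :=
  ⟨aeval_ratFunc_X_ne_zero (X_sub_C_ne_zero a),
    aeval_ratFunc_X_ne_zero (mul_ne_zero (X_sub_C_ne_zero a) (pow_ne_zero _ (X_sub_C_ne_zero b))),
    aeval_ratFunc_X_ne_zero (mul_ne_zero (X_sub_C_ne_zero a) (X_sub_C_ne_zero b))⟩

/-- `𝔥₁ = 𝔩(a) 𝔩(b)²`, `𝔥₂ = 𝔩(a) 𝔩(b)` and the degrees `3`, `2` of the radicand forms. [folklore] -/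
theorem lineE_radicands (a b : K) : 𝔥₁(K, a, b) = 𝔩(K, a) * 𝔩(K, b) ^ 2 ∧ 𝔥₂(K, a, b) = 𝔩(K, a) * 𝔩(K, b) ∧
    (((X : Polynomial K) - C a) * ((X : Polynomial K) - C b) ^ 2).natDegree = 3 ∧
    (((X : Polynomial K) - C a) * ((X : Polynomial K) - C b)).natDegree = 2 := by
  refine ⟨by rw [map_mul, map_pow], by rw [map_mul], ?_, ?_⟩
  · rw [natDegree_mul (X_sub_C_ne_zero a) (pow_ne_zero _ (X_sub_C_ne_zero b)), natDegree_pow,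
      natDegree_X_sub_C, natDegree_X_sub_C]
  · rw [natDegree_mul (X_sub_C_ne_zero a) (X_sub_C_ne_zero b), natDegree_X_sub_C, natDegree_X_sub_C]

variable [CharZero K]

/-- Non-vanishing on the line: `𝔄(v)`, `𝔅(v)`, `ℭ(v)`, `𝔇(v)`, and the constant `13824` with
`v_P(13824) = 0`. [folklore] -/
theorem seedE_ne_zero (s : K) (P : PlaceOver K (RatFunc K)) :
    𝔄ᵥ(K, s) ≠ 0 ∧ 𝔅ᵥ(K, s) ≠ 0 ∧ ℭᵥ(K, s) ≠ 0 ∧ 𝔇ᵥ(K, s) ≠ 0 ∧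
      algebraMap K (RatFunc K) (13824 : K) ≠ 0 ∧ P.ord (algebraMap K (RatFunc K) (13824 : K)) = 0 := by
  obtain ⟨hA, hB, hC, hD⟩ := formsE_ne_zero (K := K) s
  exact ⟨aeval_ratFunc_X_ne_zero hA, aeval_ratFunc_X_ne_zero hB, aeval_ratFunc_X_ne_zero hC,
    aeval_ratFunc_X_ne_zero hD, (_root_.map_ne_zero _).2 (by norm_num),
    PlaceOver.ord_algebraMap_holds P (by norm_num)⟩

omit [CharZero K] in
/-- `𝔤 = A(v)/B(v)` with `A = -𝔅 𝔄²`, `B = 13824`. [folklore] -/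
theorem seedE_eq_div (s : K) :
    𝔤(K, s) = aeval (RatFunc.X : RatFunc K) (-(𝔅(K, s) * 𝔄(K, s) ^ 2)) /
      aeval (RatFunc.X : RatFunc K) (C (13824 : K)) := by
  rw [map_neg, map_mul, map_pow, aeval_C]

omit [CharZero K] in
/-- **Klein's identity on the line**: `𝔇(v) ℭ(v)³ - 13824 = 𝔅(v) 𝔄(v)²`. [folklore] -/
theorem seedE_klein {s : K} (hs : s ^ 2 = -11) :
    𝔇ᵥ(K, s) * ℭᵥ(K, s) ^ 3 - algebraMap K (RatFunc K) (13824 : K) = 𝔅ᵥ(K, s) * 𝔄ᵥ(K, s) ^ 2 := by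
  have h := congr_arg (aeval (RatFunc.X : RatFunc K)) (formsE_identity (K := K) hs)
  rwa [map_sub, map_mul, map_pow, show (13824 : K[X]) = C (13824 : K) by rw [map_ofNat], aeval_C,
    map_mul, map_pow] at h

/-- **`𝔤 - 1 = -𝔇(v) ℭ(v)³/13824 = -J(v)`**. [folklore] -/
theorem seedE_sub_one {s : K} (hs : s ^ 2 = -11) (P : PlaceOver K (RatFunc K)) :
    𝔤(K, s) - 1 = -(𝔇ᵥ(K, s) * ℭᵥ(K, s) ^ 3) / algebraMap K (RatFunc K) (13824 : K) := by
  obtain ⟨-, -, -, -, hc, -⟩ := seedE_ne_zero (K := K) s P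
  rw [div_sub_one hc]
  congr 1
  linear_combination seedE_klein (K := K) hs

/-- **The order of the seed**: `v(𝔤) = v(𝔅(v)) + 2 v(𝔄(v))`. [folklore] -/
theorem ord_seedE (s : K) (P : PlaceOver K (RatFunc K)) :
    P.ord 𝔤(K, s) = P.ord 𝔅ᵥ(K, s) + 2 * P.ord 𝔄ᵥ(K, s) := by
  obtain ⟨hA, hB, -, -, hc, ho⟩ := seedE_ne_zero (K := K) s P
  rw [P.ord_div (neg_ne_zero.mpr (mul_ne_zero hB (pow_ne_zero _ hA))) hc, P.ord_neg, P.ord_mul_eq hB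
    (pow_ne_zero _ hA), P.ord_pow hA, ho]
  push_cast; ring

/-- **The order of `𝔤 - 1`**: `v(𝔤 - 1) = v(𝔇(v)) + 3 v(ℭ(v))`. [folklore] -/
theorem ord_seedE_sub_one {s : K} (hs : s ^ 2 = -11) (P : PlaceOver K (RatFunc K)) :
    P.ord (𝔤(K, s) - 1) = P.ord 𝔇ᵥ(K, s) + 3 * P.ord ℭᵥ(K, s) := by
  obtain ⟨-, -, hC, hD, hc, ho⟩ := seedE_ne_zero (K := K) s P
  rw [seedE_sub_one hs P, P.ord_div (neg_ne_zero.mpr (mul_ne_zero hD (pow_ne_zero _ hC))) hc, P.ord_neg,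
    P.ord_mul_eq hD (pow_ne_zero _ hC), P.ord_pow hC, ho]
  push_cast; ring

/-- **The place at infinity** (`v(v) < 0`): `v(𝔤) = v(𝔤 - 1) = -11`, `v(𝔩(a)) = -1`, `v(𝔥₁) = -3`,
`v(𝔥₂) = -2`, and `v(π₀(𝔤)) = -11 deg π₀`. [folklore] -/
theorem seedE_infty {s : K} (hs : s ^ 2 = -11) (P : PlaceOver K (RatFunc K))
    (hneg : P.ord (RatFunc.X : RatFunc K) < 0) :
    P.ord 𝔤(K, s) = -11 ∧ P.ord (𝔤(K, s) - 1) = -11 ∧ (∀ a : K, P.ord 𝔩(K, a) = -1) ∧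
      (∀ a b : K, P.ord 𝔥₁(K, a, b) = -3 ∧ P.ord 𝔥₂(K, a, b) = -2) ∧
      ∀ π₀ : K[X], π₀ ≠ 0 → P.ord (aeval 𝔤(K, s) π₀) = π₀.natDegree * (-11) := by
  have hut := RatFunc.transcendental_X (K := K)
  have hu1 := finrank_adjoin_ratFunc_X (K := K)
  obtain ⟨hA0, hB0, hC0, hD0⟩ := formsE_ne_zero (K := K) s
  obtain ⟨hdA, hdB, hdC, hdD⟩ := natDegree_formsE (K := K) s
  have hvm1 : P.ord (RatFunc.X : RatFunc K) = -1 := P.ord_eq_neg_one_of_finrank_eq_one hut hu1 hneg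
  have hoA : P.ord 𝔄ᵥ(K, s) = -4 := by rw [(P.ord_aeval_of_ord_neg hneg hA0).2, hdA, hvm1]; norm_num
  have hoB : P.ord 𝔅ᵥ(K, s) = -3 := by rw [(P.ord_aeval_of_ord_neg hneg hB0).2, hdB, hvm1]; norm_num
  have hoC : P.ord ℭᵥ(K, s) = -3 := by rw [(P.ord_aeval_of_ord_neg hneg hC0).2, hdC, hvm1]; norm_num
  have hoD : P.ord 𝔇ᵥ(K, s) = -2 := by rw [(P.ord_aeval_of_ord_neg hneg hD0).2, hdD, hvm1]; norm_num
  have hg : P.ord 𝔤(K, s) = -11 := by rw [ord_seedE, hoA, hoB]; norm_num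
  refine ⟨hg, by rw [ord_seedE_sub_one hs, hoC, hoD]; norm_num, fun a => ?_, fun a b => ⟨?_, ?_⟩,
    fun π₀ hπ => ?_⟩
  · rw [(P.ord_aeval_of_ord_neg hneg (X_sub_C_ne_zero a)).2, natDegree_X_sub_C, hvm1]; norm_num
  · obtain ⟨-, -, hd3, -⟩ := lineE_radicands (K := K) a b
    rw [(P.ord_aeval_of_ord_neg hneg (mul_ne_zero (X_sub_C_ne_zero a) (pow_ne_zero _ (X_sub_C_ne_zero b)))).2,
      hd3, hvm1]; norm_num
  · obtain ⟨-, -, -, hd2⟩ := lineE_radicands (K := K) a b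
    rw [(P.ord_aeval_of_ord_neg hneg (mul_ne_zero (X_sub_C_ne_zero a) (X_sub_C_ne_zero b))).2, hd2, hvm1]
    norm_num
  · rw [(P.ord_aeval_of_ord_neg (by rw [hg]; norm_num) hπ).2, hg]

/-- At a finite place (`v ∈ 𝒪_P`) all the forms have non-negative order, `v(𝔅(v)) = Σ v(𝔩(bᵢ))`,
`v(𝔇(v)) = v(𝔩(d₁)) + v(𝔩(d₂))`, and the two sides `𝔅 𝔄²`, `𝔇 ℭ³` do not both vanish. [folklore] -/
theorem seedE_finite {s c c' b₁ b₂ b₃ d₁ d₂ : K} (hs : s ^ 2 = -11)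
    (hB : 𝔅(K, s) = C c * (X - C b₁) * (X - C b₂) * (X - C b₃))
    (hD : 𝔇(K, s) = C c' * (X - C d₁) * (X - C d₂)) (P : PlaceOver K (RatFunc K))
    (hvO : (RatFunc.X : RatFunc K) ∈ P.toValuationSubring) :
    0 ≤ P.ord 𝔄ᵥ(K, s) ∧ 0 ≤ P.ord ℭᵥ(K, s) ∧ (∀ a : K, 0 ≤ P.ord 𝔩(K, a)) ∧
      P.ord 𝔅ᵥ(K, s) = P.ord 𝔩(K, b₁) + P.ord 𝔩(K, b₂) + P.ord 𝔩(K, b₃) ∧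
      P.ord 𝔇ᵥ(K, s) = P.ord 𝔩(K, d₁) + P.ord 𝔩(K, d₂) ∧
      ¬ (0 < P.ord 𝔤(K, s) ∧ 0 < P.ord (𝔤(K, s) - 1)) := by
  obtain ⟨hA, hB0, hC, hD0, hc, ho⟩ := seedE_ne_zero (K := K) s P
  obtain ⟨-, hB0', -, hD0'⟩ := formsE_ne_zero (K := K) s
  have hl : ∀ a : K, 𝔩(K, a) ≠ 0 := fun a => (lineE_ne_zero (K := K) a a).1
  have hcz : c ≠ 0 := by
    rintro rfl
    rw [map_zero, zero_mul, zero_mul, zero_mul] at hB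
    exact hB0' hB
  have hcz' : c' ≠ 0 := by
    rintro rfl
    rw [map_zero, zero_mul, zero_mul] at hD
    exact hD0' hD
  have h2 : algebraMap K (RatFunc K) c ≠ 0 := (_root_.map_ne_zero _).2 hcz
  have ho2 : P.ord (algebraMap K (RatFunc K) c) = 0 := PlaceOver.ord_algebraMap_holds P hcz
  have h2' : algebraMap K (RatFunc K) c' ≠ 0 := (_root_.map_ne_zero _).2 hcz'
  have ho2' : P.ord (algebraMap K (RatFunc K) c') = 0 := PlaceOver.ord_algebraMap_holds P hcz'
  refine ⟨P.ord_nonneg_of_mem (P.aeval_mem hvO _), P.ord_nonneg_of_mem (P.aeval_mem hvO _),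
    fun a => P.ord_nonneg_of_mem (P.aeval_mem hvO _), ?_, ?_, ?_⟩
  · have e : 𝔅ᵥ(K, s) = algebraMap K (RatFunc K) c * 𝔩(K, b₁) * 𝔩(K, b₂) * 𝔩(K, b₃) := by
      rw [hB, map_mul, map_mul, map_mul, aeval_C]
    rw [e, P.ord_mul_eq (mul_ne_zero (mul_ne_zero h2 (hl b₁)) (hl b₂)) (hl b₃),
      P.ord_mul_eq (mul_ne_zero h2 (hl b₁)) (hl b₂), P.ord_mul_eq h2 (hl b₁), ho2, zero_add]
  · have e : 𝔇ᵥ(K, s) = algebraMap K (RatFunc K) c' * 𝔩(K, d₁) * 𝔩(K, d₂) := by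
      rw [hD, map_mul, map_mul, aeval_C]
    rw [e, P.ord_mul_eq (mul_ne_zero h2' (hl d₁)) (hl d₂), P.ord_mul_eq h2' (hl d₁), ho2', zero_add]
  · have h := P.not_and_ord_aeval_pos_of_isCoprime hvO (isCoprime_sidesE (K := K) hs)
      (by rw [map_mul, map_pow]; exact mul_ne_zero hB0 (pow_ne_zero _ hA))
      (by rw [map_mul, map_pow]; exact mul_ne_zero hD0 (pow_ne_zero _ hC))
    have e₁ : P.ord (aeval (RatFunc.X : RatFunc K) (𝔅(K, s) * 𝔄(K, s) ^ 2)) = P.ord 𝔤(K, s) := by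
      rw [map_mul, map_pow, P.ord_mul_eq hB0 (pow_ne_zero _ hA), P.ord_pow hA, ord_seedE]; push_cast; ring
    have e₂ : P.ord (aeval (RatFunc.X : RatFunc K) (𝔇(K, s) * ℭ(K, s) ^ 3)) = P.ord (𝔤(K, s) - 1) := by
      rw [map_mul, map_pow, P.ord_mul_eq hD0 (pow_ne_zero _ hC), P.ord_pow hC, ord_seedE_sub_one hs]
      push_cast; ring
    rwa [e₁, e₂] at h

/-- **The zeros of the seed** (a finite place with `v(𝔤) > 0`): `v(𝔤 - 1) = 0`, `v(𝔥₁) = 0`, and one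
of: `𝔄(v) = 0` (`v(𝔤) = 2`, `v(𝔥₂) = v(𝔥₃) = 0`); `v = b₁` (`v(𝔤) = 1`, `v(𝔥₂) = v(𝔥₃) = 1`); `v = b₂`
(`v(𝔤) = 1`, `v(𝔥₂) = 1`, `v(𝔥₃) = 0`); `v = b₃` (`v(𝔤) = 1`, `v(𝔥₂) = 0`, `v(𝔥₃) = 1`). [folklore] -/
theorem seedE_zeros {s c c' b₁ b₂ b₃ d₁ d₂ : K} (hs : s ^ 2 = -11)
    (hB : 𝔅(K, s) = C c * (X - C b₁) * (X - C b₂) * (X - C b₃))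
    (hD : 𝔇(K, s) = C c' * (X - C d₁) * (X - C d₂)) (P : PlaceOver K (RatFunc K)) (hP : 0 < P.ord 𝔤(K, s)) :
    P.ord (𝔤(K, s) - 1) = 0 ∧ P.ord 𝔥₁(K, d₁, d₂) = 0 ∧
      ((P.ord 𝔤(K, s) = 2 ∧ P.ord 𝔥₂(K, b₁, b₂) = 0 ∧ P.ord 𝔥₂(K, b₁, b₃) = 0) ∨
        (P.ord 𝔤(K, s) = 1 ∧ P.ord 𝔥₂(K, b₁, b₂) = 1 ∧ P.ord 𝔥₂(K, b₁, b₃) = 1) ∨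
        (P.ord 𝔤(K, s) = 1 ∧ P.ord 𝔥₂(K, b₁, b₂) = 1 ∧ P.ord 𝔥₂(K, b₁, b₃) = 0) ∨
        (P.ord 𝔤(K, s) = 1 ∧ P.ord 𝔥₂(K, b₁, b₂) = 0 ∧ P.ord 𝔥₂(K, b₁, b₃) = 1)) ∧
      ∀ π₀ : K[X], π₀.eval 0 ≠ 0 → P.ord (aeval 𝔤(K, s) π₀) = 0 := by
  have hut := RatFunc.transcendental_X (K := K)
  have hu1 := finrank_adjoin_ratFunc_X (K := K)
  obtain ⟨hA, hB0, hC, hD0, hc, ho⟩ := seedE_ne_zero (K := K) s P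
  have hl : ∀ a : K, 𝔩(K, a) ≠ 0 := fun a => (lineE_ne_zero (K := K) a a).1
  -- the place is finite
  have hvO : (RatFunc.X : RatFunc K) ∈ P.toValuationSubring := by
    by_contra hvO
    have hneg : P.ord (RatFunc.X : RatFunc K) < 0 := by
      by_contra hge
      exact hvO ((P.mem_toValuationSubring_iff_ord_nonneg RatFunc.X_ne_zero).2 (not_lt.1 hge))
    have h := (seedE_infty hs P hneg).1
    omega
  obtain ⟨hnnA, hnnC, hnnl, hordB, hordD, hex⟩ := seedE_finite hs hB hD P hvO
  have hg1 : P.ord (𝔤(K, s) - 1) ≤ 0 := by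
    by_contra h; exact hex ⟨hP, not_le.1 h⟩
  have hordg := ord_seedE (K := K) s P
  have hordg1 := ord_seedE_sub_one (K := K) hs P
  -- the `J = 0` side is a unit
  have hsum1 : P.ord 𝔩(K, d₁) + P.ord 𝔩(K, d₂) + 3 * P.ord ℭᵥ(K, s) ≤ 0 := by rw [← hordD, ← hordg1]; exact hg1
  have hd1z : P.ord 𝔩(K, d₁) = 0 := by have := hnnl d₁; have := hnnl d₂; omega
  have hd2z : P.ord 𝔩(K, d₂) = 0 := by have := hnnl d₁; have := hnnl d₂; omega
  have hg1z : P.ord (𝔤(K, s) - 1) = 0 := by have := hnnl d₁; have := hnnl d₂; omega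
  obtain ⟨eh1, eh2, -, -⟩ := lineE_radicands (K := K) d₁ d₂
  have hh1 : P.ord 𝔥₁(K, d₁, d₂) = 0 := by
    rw [eh1, P.ord_mul_eq (hl d₁) (pow_ne_zero _ (hl d₂)), P.ord_pow (hl d₂), hd1z, hd2z]; norm_num
  -- coprimality inside the `J = 1728` side
  obtain ⟨hAB, -⟩ := isCoprime_withinE (K := K) hs
  obtain ⟨-, hsepB, -, -⟩ := separable_formsE (K := K) hs
  rw [hB] at hAB hsepB
  have hA1 : IsCoprime 𝔄(K, s) (X - C b₁) := ((hAB.of_mul_right_left).of_mul_right_left).of_mul_right_right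
  have hA2 : IsCoprime 𝔄(K, s) (X - C b₂) := (hAB.of_mul_right_left).of_mul_right_right
  have hA3 : IsCoprime 𝔄(K, s) (X - C b₃) := hAB.of_mul_right_right
  have h12 : IsCoprime (X - C b₁ : K[X]) (X - C b₂) :=
    ((hsepB.of_mul_left).isCoprime).of_mul_left_right
  have h13 : IsCoprime (X - C b₁ : K[X]) (X - C b₃) := (hsepB.isCoprime).of_mul_left_left.of_mul_left_right
  have h23 : IsCoprime (X - C b₂ : K[X]) (X - C b₃) := (hsepB.isCoprime).of_mul_left_right
  have hexA1 := P.not_and_ord_aeval_pos_of_isCoprime hvO hA1 hA (hl b₁)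
  have hexA2 := P.not_and_ord_aeval_pos_of_isCoprime hvO hA2 hA (hl b₂)
  have hexA3 := P.not_and_ord_aeval_pos_of_isCoprime hvO hA3 hA (hl b₃)
  have hex12 := P.not_and_ord_aeval_pos_of_isCoprime hvO h12 (hl b₁) (hl b₂)
  have hex13 := P.not_and_ord_aeval_pos_of_isCoprime hvO h13 (hl b₁) (hl b₃)
  have hex23 := P.not_and_ord_aeval_pos_of_isCoprime hvO h23 (hl b₂) (hl b₃)
  have hpos : 0 < P.ord 𝔩(K, b₁) + P.ord 𝔩(K, b₂) + P.ord 𝔩(K, b₃) + 2 * P.ord 𝔄ᵥ(K, s) := by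
    rw [← hordB, ← hordg]; exact hP
  obtain ⟨-, ehb2, -, -⟩ := lineE_radicands (K := K) b₁ b₂
  obtain ⟨-, ehb3, -, -⟩ := lineE_radicands (K := K) b₁ b₃
  have hordh2 : P.ord 𝔥₂(K, b₁, b₂) = P.ord 𝔩(K, b₁) + P.ord 𝔩(K, b₂) := by rw [ehb2, P.ord_mul_eq (hl b₁) (hl b₂)]
  have hordh3 : P.ord 𝔥₂(K, b₁, b₃) = P.ord 𝔩(K, b₁) + P.ord 𝔩(K, b₃) := by rw [ehb3, P.ord_mul_eq (hl b₁) (hl b₃)]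
  have hl1 : ∀ a : K, 0 < P.ord 𝔩(K, a) → P.ord 𝔩(K, a) = 1 := fun a ha =>
    P.ord_aeval_eq_one_of_separable_of_finrank_eq_one hut hu1 (separable_X_sub_C (x := a)) ha
  refine ⟨hg1z, hh1, ?_, fun π₀ h0 => (P.ord_aeval_eq_zero_of_eval_ne_zero hP h0).2⟩
  rcases aux_four (hnnl b₁) (hnnl b₂) (hnnl b₃) hnnA hpos hex12 hex13 hex23 hexA1 hexA2 hexA3 with
    ⟨hApos, h1, h2, h3⟩ | ⟨hAz, h1, h2, h3⟩ | ⟨hAz, h1, h2, h3⟩ | ⟨hAz, h1, h2, h3⟩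
  · left
    have hA1' : P.ord 𝔄ᵥ(K, s) = 1 :=
      P.ord_aeval_eq_one_of_separable_of_finrank_eq_one hut hu1 (separable_formsE (K := K) hs).1 hApos
    refine ⟨by rw [hordg, hordB, h1, h2, h3, hA1']; norm_num, by rw [hordh2, h1, h2]; norm_num,
      by rw [hordh3, h1, h3]; norm_num⟩
  · right; left
    have h1' := hl1 b₁ h1
    refine ⟨by rw [hordg, hordB, h1', h2, h3, hAz]; norm_num, by rw [hordh2, h1', h2]; norm_num,
      by rw [hordh3, h1', h3]; norm_num⟩
  · right; right; left
    have h2' := hl1 b₂ h2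
    refine ⟨by rw [hordg, hordB, h1, h2', h3, hAz]; norm_num, by rw [hordh2, h1, h2']; norm_num,
      by rw [hordh3, h1, h3]; norm_num⟩
  · right; right; right
    have h3' := hl1 b₃ h3
    refine ⟨by rw [hordg, hordB, h1, h2, h3', hAz]; norm_num, by rw [hordh2, h1, h2]; norm_num,
      by rw [hordh3, h1, h3']; norm_num⟩

/-- **The zeros of `𝔤 - 1`** (a finite place with `v(𝔤 - 1) > 0`): `v(𝔤) = 0`, `v(𝔥₂) = v(𝔥₃) = 0`, and
one of: `ℭ(v) = 0` (`v(𝔤 - 1) = 3`, `v(𝔥₁) = 0`); `v = d₁` (`v(𝔤 - 1) = 1`, `v(𝔥₁) = 1`); `v = d₂`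
(`v(𝔤 - 1) = 1`, `v(𝔥₁) = 2`). [folklore] -/
theorem seedE_ones {s c c' b₁ b₂ b₃ d₁ d₂ : K} (hs : s ^ 2 = -11)
    (hB : 𝔅(K, s) = C c * (X - C b₁) * (X - C b₂) * (X - C b₃))
    (hD : 𝔇(K, s) = C c' * (X - C d₁) * (X - C d₂)) (P : PlaceOver K (RatFunc K)) (hP : 0 < P.ord (𝔤(K, s) - 1)) :
    P.ord 𝔤(K, s) = 0 ∧ P.ord 𝔥₂(K, b₁, b₂) = 0 ∧ P.ord 𝔥₂(K, b₁, b₃) = 0 ∧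
      ((P.ord (𝔤(K, s) - 1) = 3 ∧ P.ord 𝔥₁(K, d₁, d₂) = 0) ∨
        (P.ord (𝔤(K, s) - 1) = 1 ∧ P.ord 𝔥₁(K, d₁, d₂) = 1) ∨
        (P.ord (𝔤(K, s) - 1) = 1 ∧ P.ord 𝔥₁(K, d₁, d₂) = 2)) ∧
      ∀ π₀ : K[X], π₀.eval 1 ≠ 0 → P.ord (aeval 𝔤(K, s) π₀) = 0 := by
  have hut := RatFunc.transcendental_X (K := K)
  have hu1 := finrank_adjoin_ratFunc_X (K := K)
  obtain ⟨hA, hB0, hC, hD0, hc, ho⟩ := seedE_ne_zero (K := K) s P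
  have hl : ∀ a : K, 𝔩(K, a) ≠ 0 := fun a => (lineE_ne_zero (K := K) a a).1
  -- the place is finite
  have hvO : (RatFunc.X : RatFunc K) ∈ P.toValuationSubring := by
    by_contra hvO
    have hneg : P.ord (RatFunc.X : RatFunc K) < 0 := by
      by_contra hge
      exact hvO ((P.mem_toValuationSubring_iff_ord_nonneg RatFunc.X_ne_zero).2 (not_lt.1 hge))
    have h := (seedE_infty hs P hneg).2.1
    omega
  obtain ⟨hnnA, hnnC, hnnl, hordB, hordD, hex⟩ := seedE_finite hs hB hD P hvO
  have hg0 : P.ord 𝔤(K, s) ≤ 0 := by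
    by_contra h; exact hex ⟨not_le.1 h, hP⟩
  have hordg := ord_seedE (K := K) s P
  have hordg1 := ord_seedE_sub_one (K := K) hs P
  -- the `J = 1728` side is a unit
  have hsum0 : P.ord 𝔩(K, b₁) + P.ord 𝔩(K, b₂) + P.ord 𝔩(K, b₃) + 2 * P.ord 𝔄ᵥ(K, s) ≤ 0 := by
    rw [← hordB, ← hordg]; exact hg0
  have hb1z : P.ord 𝔩(K, b₁) = 0 := by have := hnnl b₁; have := hnnl b₂; have := hnnl b₃; omega
  have hb2z : P.ord 𝔩(K, b₂) = 0 := by have := hnnl b₁; have := hnnl b₂; have := hnnl b₃; omega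
  have hb3z : P.ord 𝔩(K, b₃) = 0 := by have := hnnl b₁; have := hnnl b₂; have := hnnl b₃; omega
  have hgz : P.ord 𝔤(K, s) = 0 := by have := hnnl b₁; have := hnnl b₂; have := hnnl b₃; omega
  obtain ⟨-, ehb2, -, -⟩ := lineE_radicands (K := K) b₁ b₂
  obtain ⟨-, ehb3, -, -⟩ := lineE_radicands (K := K) b₁ b₃
  have hh2 : P.ord 𝔥₂(K, b₁, b₂) = 0 := by rw [ehb2, P.ord_mul_eq (hl b₁) (hl b₂), hb1z, hb2z]; norm_num
  have hh3 : P.ord 𝔥₂(K, b₁, b₃) = 0 := by rw [ehb3, P.ord_mul_eq (hl b₁) (hl b₃), hb1z, hb3z]; norm_num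
  -- coprimality inside the `J = 0` side
  obtain ⟨-, hCD⟩ := isCoprime_withinE (K := K) hs
  obtain ⟨-, -, -, hsepD⟩ := separable_formsE (K := K) hs
  rw [hD] at hCD hsepD
  have hC1 : IsCoprime ℭ(K, s) (X - C d₁) := (hCD.of_mul_right_left).of_mul_right_right
  have hC2 : IsCoprime ℭ(K, s) (X - C d₂) := hCD.of_mul_right_right
  have h12 : IsCoprime (X - C d₁ : K[X]) (X - C d₂) := (hsepD.isCoprime).of_mul_left_right
  have hexC1 := P.not_and_ord_aeval_pos_of_isCoprime hvO hC1 hC (hl d₁)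
  have hexC2 := P.not_and_ord_aeval_pos_of_isCoprime hvO hC2 hC (hl d₂)
  have hex12 := P.not_and_ord_aeval_pos_of_isCoprime hvO h12 (hl d₁) (hl d₂)
  have hpos : 0 < P.ord 𝔩(K, d₁) + P.ord 𝔩(K, d₂) + 3 * P.ord ℭᵥ(K, s) := by
    rw [← hordD, ← hordg1]; exact hP
  obtain ⟨eh1, -, -, -⟩ := lineE_radicands (K := K) d₁ d₂
  have hordh1 : P.ord 𝔥₁(K, d₁, d₂) = P.ord 𝔩(K, d₁) + 2 * P.ord 𝔩(K, d₂) := by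
    rw [eh1, P.ord_mul_eq (hl d₁) (pow_ne_zero _ (hl d₂)), P.ord_pow (hl d₂)]; push_cast; ring
  have hl1 : ∀ a : K, 0 < P.ord 𝔩(K, a) → P.ord 𝔩(K, a) = 1 := fun a ha =>
    P.ord_aeval_eq_one_of_separable_of_finrank_eq_one hut hu1 (separable_X_sub_C (x := a)) ha
  refine ⟨hgz, hh2, hh3, ?_, fun π₀ h1 => ord_aeval_eq_zero_of_ord_sub_one_pos P hP h1⟩
  rcases aux_three (hnnl d₁) (hnnl d₂) hnnC hpos hex12 hexC1 hexC2 with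
    ⟨hCpos, h1, h2⟩ | ⟨hCz, h1, h2⟩ | ⟨hCz, h1, h2⟩
  · left
    have hC1' : P.ord ℭᵥ(K, s) = 1 :=
      P.ord_aeval_eq_one_of_separable_of_finrank_eq_one hut hu1 (separable_formsE (K := K) hs).2.2.1 hCpos
    exact ⟨by rw [hordg1, hordD, h1, h2, hC1']; norm_num, by rw [hordh1, h1, h2]; norm_num⟩
  · right; left
    have h1' := hl1 d₁ h1
    exact ⟨by rw [hordg1, hordD, h1', h2, hCz]; norm_num, by rw [hordh1, h1', h2]; norm_num⟩
  · right; right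
    have h2' := hl1 d₂ h2
    exact ⟨by rw [hordg1, hordD, h1, h2', hCz]; norm_num, by rw [hordh1, h1, h2']; norm_num⟩

/-- **The poles of the seed** are at infinity: `v(𝔤) = -11`, `v(𝔥₁) = -3`, `v(𝔥₂) = v(𝔥₃) = -2`.
[folklore] -/
theorem seedE_poles {s : K} (hs : s ^ 2 = -11) (P : PlaceOver K (RatFunc K)) (hP : P.ord 𝔤(K, s) < 0)
    (d₁ d₂ b₁ b₂ b₃ : K) :
    P.ord 𝔤(K, s) = -11 ∧ P.ord 𝔥₁(K, d₁, d₂) = -3 ∧ P.ord 𝔥₂(K, b₁, b₂) = -2 ∧ P.ord 𝔥₂(K, b₁, b₃) = -2 := by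
  obtain ⟨hA, hB0, -, -, hc, ho⟩ := seedE_ne_zero (K := K) s P
  have hneg : P.ord (RatFunc.X : RatFunc K) < 0 := by
    by_contra hge
    have hvO : (RatFunc.X : RatFunc K) ∈ P.toValuationSubring :=
      (P.mem_toValuationSubring_iff_ord_nonneg RatFunc.X_ne_zero).2 (not_lt.1 hge)
    have h1 : 0 ≤ P.ord 𝔄ᵥ(K, s) := P.ord_nonneg_of_mem (P.aeval_mem hvO _)
    have h2 : 0 ≤ P.ord 𝔅ᵥ(K, s) := P.ord_nonneg_of_mem (P.aeval_mem hvO _)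
    have h := ord_seedE (K := K) s P
    omega
  obtain ⟨hg, -, -, hh, -⟩ := seedE_infty hs P hneg
  exact ⟨hg, (hh d₁ d₂).1, (hh b₁ b₂).2, (hh b₁ b₃).2⟩

/-- **The seed is non-zero and transcendental** (it has the pole `v = ∞`), and is not annihilated by a
non-zero polynomial. [cite: Stichtenoth2009, Prop. 1.1.5(c), Cor. 1.1.20] -/
theorem seedE_transcendental (s : K) :
    𝔤(K, s) ≠ 0 ∧ Transcendental K 𝔤(K, s) ∧ ∀ π₀ : K[X], π₀ ≠ 0 → aeval 𝔤(K, s) π₀ ≠ 0 := by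
  have hut := RatFunc.transcendental_X (K := K)
  have hu1 := finrank_adjoin_ratFunc_X (K := K)
  obtain ⟨hA0, hB0, -, -⟩ := formsE_ne_zero (K := K) s
  obtain ⟨hdA, hdB, -, -⟩ := natDegree_formsE (K := K) s
  have hv0 : (RatFunc.X : RatFunc K) ≠ 0 := RatFunc.X_ne_zero
  have hvi : Transcendental K (RatFunc.X : RatFunc K)⁻¹ := fun h => hut (IsAlgebraic.inv_iff.1 h)
  obtain ⟨P, hP⟩ := exists_ord_pos_of_transcendental hvi
  have hneg : P.ord (RatFunc.X : RatFunc K) < 0 := by rw [P.ord_inv hv0] at hP; omega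
  obtain ⟨hA, hB, -, -, hc, ho⟩ := seedE_ne_zero (K := K) s P
  have hg0 : 𝔤(K, s) ≠ 0 := div_ne_zero (neg_ne_zero.mpr (mul_ne_zero hB (pow_ne_zero _ hA))) hc
  have hvm1 : P.ord (RatFunc.X : RatFunc K) = -1 := P.ord_eq_neg_one_of_finrank_eq_one hut hu1 hneg
  have hoA : P.ord 𝔄ᵥ(K, s) = -4 := by rw [(P.ord_aeval_of_ord_neg hneg hA0).2, hdA, hvm1]; norm_num
  have hoB : P.ord 𝔅ᵥ(K, s) = -3 := by rw [(P.ord_aeval_of_ord_neg hneg hB0).2, hdB, hvm1]; norm_num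
  have hpole : P.ord 𝔤(K, s) < 0 := by rw [ord_seedE, hoA, hoB]; norm_num
  have htr : Transcendental K 𝔤(K, s) := by
    intro halg
    have hmem := IsAlgFunctionField.mem_valuationSubring_of_isAlgebraic P.toValuationSubring
      P.algebraMap_mem halg
    have := (P.mem_toValuationSubring_iff_ord_nonneg hg0).1 hmem
    omega
  exact ⟨hg0, htr, fun π₀ hπ h => htr ⟨π₀, hπ, h⟩⟩

/-- **The other closed points are unramified for the seed.** For `π₀` monic irreducible,
`π₀ ∉ {X, X - 1}`, at every zero `P` of `π₀(𝔤)` on the line: `v_P(π₀(𝔤)) = 1` and the three radicands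
are units. The place is finite and generic, and there `v_P(π₀(𝔤)) = v_P(Ñ(v))` for the homogenised
pull-back of `π₀` under `A/B = -𝔅 𝔄²/13824`, separable by `pullback_separable` (Wronskian
`-13824 · 11 · 𝔄 ℭ²`, `A - B = -𝔇 ℭ³`). [folklore] -/
theorem seedE_elsewhere {s c c' b₁ b₂ b₃ d₁ d₂ : K} (hs : s ^ 2 = -11)
    (hB : 𝔅(K, s) = C c * (X - C b₁) * (X - C b₂) * (X - C b₃))
    (hD : 𝔇(K, s) = C c' * (X - C d₁) * (X - C d₂))
    {π₀ : K[X]} (hπi : Irreducible π₀) (hπm : π₀.Monic) (hπX : π₀ ≠ X) (hπX1 : π₀ ≠ X - 1)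
    (P : PlaceOver K (RatFunc K)) (hP : 0 < P.ord (aeval 𝔤(K, s) π₀)) :
    P.ord (aeval 𝔤(K, s) π₀) = 1 ∧ P.ord 𝔥₁(K, d₁, d₂) = 0 ∧ P.ord 𝔥₂(K, b₁, b₂) = 0 ∧
      P.ord 𝔥₂(K, b₁, b₃) = 0 := by
  have hut := RatFunc.transcendental_X (K := K)
  have hu1 := finrank_adjoin_ratFunc_X (K := K)
  have hl : ∀ a : K, 𝔩(K, a) ≠ 0 := fun a => (lineE_ne_zero (K := K) a a).1
  have h0 : π₀.eval 0 ≠ 0 := fun h0 => hπX (by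
    have h := PlaceOver.eq_X_sub_C_of_irreducible_of_eval_eq_zero hπi hπm h0
    rwa [map_zero, sub_zero] at h)
  have h1 : π₀.eval 1 ≠ 0 := fun h1 => hπX1 (by
    have h := PlaceOver.eq_X_sub_C_of_irreducible_of_eval_eq_zero hπi hπm h1
    rwa [map_one] at h)
  -- the place is finite
  have hvO : (RatFunc.X : RatFunc K) ∈ P.toValuationSubring := by
    by_contra hvO
    have hneg : P.ord (RatFunc.X : RatFunc K) < 0 := by
      by_contra hge
      exact hvO ((P.mem_toValuationSubring_iff_ord_nonneg RatFunc.X_ne_zero).2 (not_lt.1 hge))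
    have h := (seedE_infty hs P hneg).2.2.2.2 π₀ hπi.ne_zero
    rw [h] at hP
    have h5 : (π₀.natDegree : ℤ) * (-11) ≤ 0 := mul_nonpos_of_nonneg_of_nonpos (by positivity) (by norm_num)
    exact absurd hP (not_lt.2 h5)
  -- and generic
  have hgz : ¬ 0 < P.ord 𝔤(K, s) := fun hg => by
    have h := (seedE_zeros hs hB hD P hg).2.2.2 π₀ h0
    rw [h] at hP; exact lt_irrefl _ hP
  have hg1z : ¬ 0 < P.ord (𝔤(K, s) - 1) := fun hg => by
    have h := (seedE_ones hs hB hD P hg).2.2.2.2 π₀ h1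
    rw [h] at hP; exact lt_irrefl _ hP
  obtain ⟨hnnA, hnnC, hnnl, hordB, hordD, -⟩ := seedE_finite hs hB hD P hvO
  have hordg := ord_seedE (K := K) s P
  have hordg1 := ord_seedE_sub_one (K := K) hs P
  have hb1z : P.ord 𝔩(K, b₁) = 0 := by have := hnnl b₁; have := hnnl b₂; have := hnnl b₃; omega
  have hb2z : P.ord 𝔩(K, b₂) = 0 := by have := hnnl b₁; have := hnnl b₂; have := hnnl b₃; omega
  have hb3z : P.ord 𝔩(K, b₃) = 0 := by have := hnnl b₁; have := hnnl b₂; have := hnnl b₃; omega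
  have hd1z : P.ord 𝔩(K, d₁) = 0 := by have := hnnl d₁; have := hnnl d₂; omega
  have hd2z : P.ord 𝔩(K, d₂) = 0 := by have := hnnl d₁; have := hnnl d₂; omega
  obtain ⟨eh1, -, -, -⟩ := lineE_radicands (K := K) d₁ d₂
  obtain ⟨-, ehb2, -, -⟩ := lineE_radicands (K := K) b₁ b₂
  obtain ⟨-, ehb3, -, -⟩ := lineE_radicands (K := K) b₁ b₃
  have hh1 : P.ord 𝔥₁(K, d₁, d₂) = 0 := by
    rw [eh1, P.ord_mul_eq (hl d₁) (pow_ne_zero _ (hl d₂)), P.ord_pow (hl d₂), hd1z, hd2z]; norm_num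
  have hh2 : P.ord 𝔥₂(K, b₁, b₂) = 0 := by rw [ehb2, P.ord_mul_eq (hl b₁) (hl b₂), hb1z, hb2z]; norm_num
  have hh3 : P.ord 𝔥₂(K, b₁, b₃) = 0 := by rw [ehb3, P.ord_mul_eq (hl b₁) (hl b₃), hb1z, hb3z]; norm_num
  refine ⟨?_, hh1, hh2, hh3⟩
  obtain ⟨hA, hB0, hC, hD0, hc, ho⟩ := seedE_ne_zero (K := K) s P
  -- the homogenised pull-back of `π₀` under `A/B`
  set A : K[X] := -(𝔅(K, s) * 𝔄(K, s) ^ 2) with hA'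
  set B : K[X] := C (13824 : K) with hB'
  set N : K[X] := ∑ j ∈ Finset.range (π₀.natDegree + 1),
    C (π₀.coeff j) * A ^ j * B ^ (π₀.natDegree - j) with hN
  have haB : aeval (RatFunc.X : RatFunc K) B = algebraMap K (RatFunc K) (13824 : K) := by rw [hB', aeval_C]
  have haB0 : aeval (RatFunc.X : RatFunc K) B ≠ 0 := by rw [haB]; exact hc
  have hNf : aeval (RatFunc.X : RatFunc K) N = aeval (RatFunc.X : RatFunc K) B ^ π₀.natDegree *
      aeval 𝔤(K, s) π₀ := by
    rw [hN, aeval_pullback_eq π₀ A B haB0, ← seedE_eq_div]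
  have hπf0 : aeval 𝔤(K, s) π₀ ≠ 0 := (seedE_transcendental s).2.2 _ hπi.ne_zero
  have hN0 : N ≠ 0 := by
    intro h
    rw [h, map_zero] at hNf
    exact mul_ne_zero (pow_ne_zero _ haB0) hπf0 hNf.symm
  -- coprimality and the Wronskian
  have hu : IsUnit (C (13824 : K) : K[X]) := isUnit_C.mpr (by norm_num : (13824 : K) ≠ 0).isUnit
  have h11 : IsUnit (C ((11 : ℕ) : K) : K[X]) := isUnit_C_ofNat'' (K := K) (by norm_num)
  have hcop : IsCoprime A B := by
    rw [hA', hB']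
    simpa using (isCoprime_mul_unit_left_right hu (-(𝔅(K, s) * 𝔄(K, s) ^ 2)) 1).2 isCoprime_one_right
  have hW : ∀ ρ : K[X], Irreducible ρ → ρ ∣ derivative A * B - A * derivative B →
      ρ ∣ A ∨ ρ ∣ B ∨ ρ ∣ A - B := by
    intro ρ hρ hdvd
    rw [hA', hB', wronskianE hs] at hdvd
    have hp := hρ.prime
    rcases hp.dvd_or_dvd hdvd with h | h
    · rcases hp.dvd_or_dvd h with h | h
      · rw [dvd_neg] at h
        rcases hp.dvd_or_dvd h with h | h
        · exact (hρ.not_isUnit (isUnit_of_dvd_unit h hu)).elim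
        · exact (hρ.not_isUnit (isUnit_of_dvd_unit h h11)).elim
      · left; rw [hA', dvd_neg]
        exact dvd_mul_of_dvd_right (h.trans (dvd_pow_self _ two_ne_zero)) _
    · right; right
      have e : A - B = -(𝔇(K, s) * ℭ(K, s) ^ 3) := by
        rw [hA', hB', map_ofNat]
        linear_combination formsE_identity (K := K) hs
      rw [e, dvd_neg]
      exact dvd_mul_of_dvd_right ((hp.dvd_of_dvd_pow h).trans (dvd_pow_self _ three_ne_zero)) _
  have hsep : N.Separable := pullback_separable hπi hπm hπX hπX1 hcop hW hN0
  have hordB' : P.ord (aeval (RatFunc.X : RatFunc K) B) = 0 := by rw [haB, ho]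
  have hordN : P.ord (aeval (RatFunc.X : RatFunc K) N) = P.ord (aeval 𝔤(K, s) π₀) := by
    rw [hNf, P.ord_mul_eq (pow_ne_zero _ haB0) hπf0, P.ord_pow haB0, hordB', mul_zero, zero_add]
  have h := P.ord_aeval_eq_one_of_separable_of_finrank_eq_one hut hu1 hsep (by rw [hordN]; exact hP)
  rwa [hordN] at h

end Seed

/-! ### C. The index of a Kummer layer at one place (the two extreme cases, packaged) -/

namespace PlaceOver

variable {K : Type u} {F : Type v} {F' : Type v} [Field K] [Field F] [Algebra K F]
variable [Field F'] [Algebra F F'] [Algebra K F'] [IsScalarTower K F F']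
variable [IsAlgFunctionField K F] [IsAlgFunctionField K F'] [FiniteDimensional F F']
  [Algebra.IsSeparable F F']

/-- **The index of a Kummer layer at a place.** For `F' = F(g)`, `g^q = h` (`q ≠ 0` in `K`) and a place
`Q` of `F'` above `P`: `v_Q(x) = e · v_P(x)` for every `x ∈ F` with `e = e(Q|P) ≥ 1`, and `e = 1` if
`q ∣ v_P(h)`, `e = q` if `v_P(h)` is prime to `q`. [cite: Stichtenoth2009, Prop. 3.7.3(b)] -/
theorem exists_index_of_pow_eq {q : ℕ} (hq : 0 < q) (hqK : (q : K) ≠ 0) {h : F} (hh0 : h ≠ 0) {g : F'}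
    (hg : g ^ q = algebraMap F F' h) (hgen : F⟮g⟯ = ⊤) (Q : PlaceOver K F') :
    ∃ e : ℤ, 1 ≤ e ∧ (∀ x : F, Q.ord (algebraMap F F' x) = e * (Q.restrict (K := K) (F := F)).ord x) ∧
      (((q : ℤ) ∣ (Q.restrict (K := K) (F := F)).ord h) → e = 1) ∧
      (IsCoprime ((Q.restrict (K := K) (F := F)).ord h) (q : ℤ) → e = q) :=
  ⟨Q.ord (algebraMap F F' ((Q.restrict (K := K) (F := F)).uniformizer : F)),
    Q.one_le_ord_algebraMap_uniformizer (K := K) (F := F),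
    fun x => Q.ord_algebraMap_eq_mul (K := K) (F := F) x,
    fun hdvd => (Q.restrict (K := K) (F := F)).ord_algebraMap_uniformizer_eq_one_of_pow_eq_of_dvd hq hqK hh0
      hdvd hg hgen Q rfl,
    fun hcop => ((Q.restrict (K := K) (F := F)).ord_algebraMap_uniformizer_eq_of_pow_eq_of_isCoprime hq hh0
      hcop hg hgen Q rfl).1⟩

end PlaceOver

section Aux

/-- `0 < e a` with `e ≥ 1` forces `0 < a`. [folklore] -/
private theorem aux_pos_of_mul {e a : ℤ} (he : 1 ≤ e) (h : 0 < e * a) : 0 < a := by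
  by_contra hle
  exact absurd h (not_lt.2 (mul_nonpos_of_nonneg_of_nonpos (by omega) (not_lt.1 hle)))

/-- `e a < 0` with `e ≥ 1` forces `a < 0`. [folklore] -/
private theorem aux_neg_of_mul {e a : ℤ} (he : 1 ≤ e) (h : e * a < 0) : a < 0 := by
  by_contra hle
  exact absurd h (not_lt.2 (mul_nonneg (by omega) (not_lt.1 hle)))

end Aux

/-! ### D. After the cubic layer `F₁ = K(v)(g₁)`, `g₁³ = 𝔥₁ = (v - d₁)(v - d₂)²` -/

section Layer1

variable {K : Type u} [Field K] [CharZero K]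
variable {F₁ : Type u} [Field F₁] [Algebra (RatFunc K) F₁] [Algebra K F₁]
  [IsScalarTower K (RatFunc K) F₁] [FiniteDimensional (RatFunc K) F₁]
  [Algebra.IsSeparable (RatFunc K) F₁]

/-- **Layer 1, zeros of the seed**: the cubic layer is unramified there (`𝔥₁` is a unit), so the four
kinds of zeros of `seedE_zeros` persist with the same orders of `𝔤`, `𝔥₂`, `𝔥₃`.
[cite: Stichtenoth2009, Prop. 3.7.3] -/
theorem layer1E_zeros {s c c' b₁ b₂ b₃ d₁ d₂ : K} (hs : s ^ 2 = -11)
    (hB : 𝔅(K, s) = C c * (X - C b₁) * (X - C b₂) * (X - C b₃))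
    (hD : 𝔇(K, s) = C c' * (X - C d₁) * (X - C d₂)) {g₁ : F₁}
    (hg₁ : g₁ ^ 3 = algebraMap (RatFunc K) F₁ 𝔥₁(K, d₁, d₂))
    (hgen₁ : IntermediateField.adjoin (RatFunc K) {g₁} = ⊤) (Q : PlaceOver K F₁)
    (hQ : 0 < Q.ord (algebraMap (RatFunc K) F₁ 𝔤(K, s))) :
    (Q.ord (algebraMap (RatFunc K) F₁ 𝔤(K, s)) = 2 ∧ Q.ord (algebraMap (RatFunc K) F₁ 𝔥₂(K, b₁, b₂)) = 0 ∧
        Q.ord (algebraMap (RatFunc K) F₁ 𝔥₂(K, b₁, b₃)) = 0) ∨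
      (Q.ord (algebraMap (RatFunc K) F₁ 𝔤(K, s)) = 1 ∧ Q.ord (algebraMap (RatFunc K) F₁ 𝔥₂(K, b₁, b₂)) = 1 ∧
        Q.ord (algebraMap (RatFunc K) F₁ 𝔥₂(K, b₁, b₃)) = 1) ∨
      (Q.ord (algebraMap (RatFunc K) F₁ 𝔤(K, s)) = 1 ∧ Q.ord (algebraMap (RatFunc K) F₁ 𝔥₂(K, b₁, b₂)) = 1 ∧
        Q.ord (algebraMap (RatFunc K) F₁ 𝔥₂(K, b₁, b₃)) = 0) ∨
      (Q.ord (algebraMap (RatFunc K) F₁ 𝔤(K, s)) = 1 ∧ Q.ord (algebraMap (RatFunc K) F₁ 𝔥₂(K, b₁, b₂)) = 0 ∧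
        Q.ord (algebraMap (RatFunc K) F₁ 𝔥₂(K, b₁, b₃)) = 1) := by
  haveI : IsAlgFunctionField K F₁ := isAlgFunctionField_of_finiteDimensional (K := K) (F := RatFunc K)
  have h3K : ((3 : ℕ) : K) ≠ 0 := by norm_num
  obtain ⟨-, hh10, -⟩ := lineE_ne_zero (K := K) d₁ d₂
  obtain ⟨e, he1, hmul, hdvd, -⟩ :=
    Q.exists_index_of_pow_eq (K := K) (F := RatFunc K) (by norm_num) h3K hh10 hg₁ hgen₁
  set P := Q.restrict (K := K) (F := RatFunc K) with hP
  have hPg : 0 < P.ord 𝔤(K, s) := aux_pos_of_mul he1 (by rw [← hmul]; exact hQ)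
  obtain ⟨-, hh1, hcases, -⟩ := seedE_zeros hs hB hD P hPg
  have he : e = 1 := hdvd (by rw [hh1]; exact dvd_zero _)
  rw [hmul, hmul, hmul, he, one_mul, one_mul, one_mul]
  exact hcases

/-- **Layer 1, zeros of `𝔤 - 1`**: above `ℭ(v) = 0` the layer is unramified (`v(𝔤 - 1) = 3` already),
above `v = d₁, d₂` it is totally ramified (`v(𝔥₁) = 1, 2` prime to `3`) and `v(𝔤 - 1) = 1` becomes
`3`; in all cases `𝔥₂`, `𝔥₃` stay units. [cite: Stichtenoth2009, Prop. 3.7.3] -/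
theorem layer1E_ones {s c c' b₁ b₂ b₃ d₁ d₂ : K} (hs : s ^ 2 = -11)
    (hB : 𝔅(K, s) = C c * (X - C b₁) * (X - C b₂) * (X - C b₃))
    (hD : 𝔇(K, s) = C c' * (X - C d₁) * (X - C d₂)) {g₁ : F₁}
    (hg₁ : g₁ ^ 3 = algebraMap (RatFunc K) F₁ 𝔥₁(K, d₁, d₂))
    (hgen₁ : IntermediateField.adjoin (RatFunc K) {g₁} = ⊤) (Q : PlaceOver K F₁)
    (hQ : 0 < Q.ord (algebraMap (RatFunc K) F₁ (𝔤(K, s) - 1))) :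
    Q.ord (algebraMap (RatFunc K) F₁ (𝔤(K, s) - 1)) = 3 ∧ Q.ord (algebraMap (RatFunc K) F₁ 𝔥₂(K, b₁, b₂)) = 0 ∧
      Q.ord (algebraMap (RatFunc K) F₁ 𝔥₂(K, b₁, b₃)) = 0 := by
  haveI : IsAlgFunctionField K F₁ := isAlgFunctionField_of_finiteDimensional (K := K) (F := RatFunc K)
  have h3K : ((3 : ℕ) : K) ≠ 0 := by norm_num
  obtain ⟨-, hh10, -⟩ := lineE_ne_zero (K := K) d₁ d₂
  obtain ⟨e, he1, hmul, hdvd, hcop⟩ :=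
    Q.exists_index_of_pow_eq (K := K) (F := RatFunc K) (by norm_num) h3K hh10 hg₁ hgen₁
  set P := Q.restrict (K := K) (F := RatFunc K) with hP
  have hPg : 0 < P.ord (𝔤(K, s) - 1) := aux_pos_of_mul he1 (by rw [← hmul]; exact hQ)
  obtain ⟨-, hh2, hh3, hcases, -⟩ := seedE_ones hs hB hD P hPg
  rw [hmul, hmul, hmul, hh2, hh3, mul_zero]
  rcases hcases with ⟨hg1, hh1⟩ | ⟨hg1, hh1⟩ | ⟨hg1, hh1⟩
  · have he : e = 1 := hdvd (by rw [hh1]; exact dvd_zero _)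
    rw [he, hg1]; norm_num
  · have he : e = 3 := hcop (by rw [hh1]; exact isCoprime_one_left)
    rw [he, hg1]; norm_num
  · have he : e = 3 := hcop (by rw [hh1]; exact ⟨-1, 1, by norm_num⟩)
    rw [he, hg1]; norm_num

/-- **Layer 1, poles of the seed** (above `v = ∞`): unramified (`v(𝔥₁) = -3`), `v(𝔤) = -11`,
`v(𝔥₂) = v(𝔥₃) = -2`. [cite: Stichtenoth2009, Prop. 3.7.3] -/
theorem layer1E_poles {s : K} (hs : s ^ 2 = -11) (b₁ b₂ b₃ : K) {d₁ d₂ : K} {g₁ : F₁}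
    (hg₁ : g₁ ^ 3 = algebraMap (RatFunc K) F₁ 𝔥₁(K, d₁, d₂))
    (hgen₁ : IntermediateField.adjoin (RatFunc K) {g₁} = ⊤) (Q : PlaceOver K F₁)
    (hQ : Q.ord (algebraMap (RatFunc K) F₁ 𝔤(K, s)) < 0) :
    Q.ord (algebraMap (RatFunc K) F₁ 𝔤(K, s)) = -11 ∧ Q.ord (algebraMap (RatFunc K) F₁ 𝔥₂(K, b₁, b₂)) = -2 ∧
      Q.ord (algebraMap (RatFunc K) F₁ 𝔥₂(K, b₁, b₃)) = -2 := by
  haveI : IsAlgFunctionField K F₁ := isAlgFunctionField_of_finiteDimensional (K := K) (F := RatFunc K)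
  have h3K : ((3 : ℕ) : K) ≠ 0 := by norm_num
  obtain ⟨-, hh10, -⟩ := lineE_ne_zero (K := K) d₁ d₂
  obtain ⟨e, he1, hmul, hdvd, -⟩ :=
    Q.exists_index_of_pow_eq (K := K) (F := RatFunc K) (by norm_num) h3K hh10 hg₁ hgen₁
  set P := Q.restrict (K := K) (F := RatFunc K) with hP
  have hPg : P.ord 𝔤(K, s) < 0 := aux_neg_of_mul he1 (by rw [← hmul]; exact hQ)
  obtain ⟨hg, hh1, hh2, hh3⟩ := seedE_poles hs P hPg d₁ d₂ b₁ b₂ b₃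
  have he : e = 1 := hdvd (by rw [hh1]; exact ⟨-1, by norm_num⟩)
  rw [hmul, hmul, hmul, he, hg, hh2, hh3]; norm_num

/-- **Layer 1, the other closed points**: unramified, `v(π₀(𝔤)) = 1`, `𝔥₂`, `𝔥₃` units.
[cite: Stichtenoth2009, Prop. 3.7.3] -/
theorem layer1E_elsewhere {s c c' b₁ b₂ b₃ d₁ d₂ : K} (hs : s ^ 2 = -11)
    (hB : 𝔅(K, s) = C c * (X - C b₁) * (X - C b₂) * (X - C b₃))
    (hD : 𝔇(K, s) = C c' * (X - C d₁) * (X - C d₂)) {g₁ : F₁}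
    (hg₁ : g₁ ^ 3 = algebraMap (RatFunc K) F₁ 𝔥₁(K, d₁, d₂))
    (hgen₁ : IntermediateField.adjoin (RatFunc K) {g₁} = ⊤) {π₀ : K[X]} (hπi : Irreducible π₀)
    (hπm : π₀.Monic) (hπX : π₀ ≠ X) (hπX1 : π₀ ≠ X - 1) (Q : PlaceOver K F₁)
    (hQ : 0 < Q.ord (algebraMap (RatFunc K) F₁ (aeval 𝔤(K, s) π₀))) :
    Q.ord (algebraMap (RatFunc K) F₁ (aeval 𝔤(K, s) π₀)) = 1 ∧
      Q.ord (algebraMap (RatFunc K) F₁ 𝔥₂(K, b₁, b₂)) = 0 ∧ Q.ord (algebraMap (RatFunc K) F₁ 𝔥₂(K, b₁, b₃)) = 0 := by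
  haveI : IsAlgFunctionField K F₁ := isAlgFunctionField_of_finiteDimensional (K := K) (F := RatFunc K)
  have h3K : ((3 : ℕ) : K) ≠ 0 := by norm_num
  obtain ⟨-, hh10, -⟩ := lineE_ne_zero (K := K) d₁ d₂
  obtain ⟨e, he1, hmul, hdvd, -⟩ :=
    Q.exists_index_of_pow_eq (K := K) (F := RatFunc K) (by norm_num) h3K hh10 hg₁ hgen₁
  set P := Q.restrict (K := K) (F := RatFunc K) with hP
  have hPg : 0 < P.ord (aeval 𝔤(K, s) π₀) := aux_pos_of_mul he1 (by rw [← hmul]; exact hQ)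
  obtain ⟨h1, hh1, hh2, hh3⟩ := seedE_elsewhere hs hB hD hπi hπm hπX hπX1 P hPg
  have he : e = 1 := hdvd (by rw [hh1]; exact dvd_zero _)
  rw [hmul, hmul, hmul, he, h1, hh2, hh3]; norm_num

end Layer1

/-! ### E. After the first quadratic layer `F₂ = F₁(g₂)`, `g₂² = 𝔥₂ = (v - b₁)(v - b₂)` -/

section Layer2

variable {K : Type u} [Field K] [CharZero K]
variable {F₁ : Type u} [Field F₁] [Algebra (RatFunc K) F₁] [Algebra K F₁]
  [IsScalarTower K (RatFunc K) F₁] [FiniteDimensional (RatFunc K) F₁]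
  [Algebra.IsSeparable (RatFunc K) F₁]
variable {F₂ : Type u} [Field F₂] [Algebra F₁ F₂] [Algebra K F₂] [IsScalarTower K F₁ F₂]
  [FiniteDimensional F₁ F₂] [Algebra.IsSeparable F₁ F₂]

/-- **Layer 2, zeros of the seed**: above `𝔄(v) = 0` unramified (`v(𝔤) = 2`, `𝔥₃` unit); above
`v = b₁` totally ramified (`v(𝔤) = 2`, `v(𝔥₃) = 2`); above `v = b₂` totally ramified (`v(𝔤) = 2`,
`𝔥₃` unit); above `v = b₃` unramified (`v(𝔤) = 1`, `v(𝔥₃) = 1`) — the hypothesis of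
`PlaceOver.ord_algebraMap_eq_of_forall_ord_pos_mixed` for the last layer. [cite: Stichtenoth2009, Prop. 3.7.3] -/
theorem layer2E_zeros {s c c' b₁ b₂ b₃ d₁ d₂ : K} (hs : s ^ 2 = -11)
    (hB : 𝔅(K, s) = C c * (X - C b₁) * (X - C b₂) * (X - C b₃))
    (hD : 𝔇(K, s) = C c' * (X - C d₁) * (X - C d₂)) {g₁ : F₁}
    (hg₁ : g₁ ^ 3 = algebraMap (RatFunc K) F₁ 𝔥₁(K, d₁, d₂))
    (hgen₁ : IntermediateField.adjoin (RatFunc K) {g₁} = ⊤) {g₂ : F₂}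
    (hg₂ : g₂ ^ 2 = algebraMap F₁ F₂ (algebraMap (RatFunc K) F₁ 𝔥₂(K, b₁, b₂)))
    (hgen₂ : IntermediateField.adjoin F₁ {g₂} = ⊤) (R : PlaceOver K F₂)
    (hR : 0 < R.ord (algebraMap F₁ F₂ (algebraMap (RatFunc K) F₁ 𝔤(K, s)))) :
    (R.ord (algebraMap F₁ F₂ (algebraMap (RatFunc K) F₁ 𝔤(K, s))) = 2 ∧
        ((2 : ℕ) : ℤ) ∣ R.ord (algebraMap F₁ F₂ (algebraMap (RatFunc K) F₁ 𝔥₂(K, b₁, b₃)))) ∨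
      (((2 : ℕ) : ℤ) * R.ord (algebraMap F₁ F₂ (algebraMap (RatFunc K) F₁ 𝔤(K, s))) = 2 ∧
        IsCoprime (R.ord (algebraMap F₁ F₂ (algebraMap (RatFunc K) F₁ 𝔥₂(K, b₁, b₃)))) ((2 : ℕ) : ℤ)) := by
  haveI : IsAlgFunctionField K F₁ := isAlgFunctionField_of_finiteDimensional (K := K) (F := RatFunc K)
  haveI : IsAlgFunctionField K F₂ := isAlgFunctionField_of_finiteDimensional (K := K) (F := F₁)
  have h2K : ((2 : ℕ) : K) ≠ 0 := by norm_num
  obtain ⟨-, -, hh20⟩ := lineE_ne_zero (K := K) b₁ b₂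
  have hH20 : algebraMap (RatFunc K) F₁ 𝔥₂(K, b₁, b₂) ≠ 0 := (_root_.map_ne_zero _).2 hh20
  obtain ⟨e, he1, hmul, hdvd, hcop⟩ := R.exists_index_of_pow_eq (K := K) (F := F₁) two_pos h2K hH20 hg₂ hgen₂
  set Q := R.restrict (K := K) (F := F₁) with hQ'
  have hQg : 0 < Q.ord (algebraMap (RatFunc K) F₁ 𝔤(K, s)) := aux_pos_of_mul he1 (by rw [← hmul]; exact hR)
  rw [hmul, hmul]
  rcases layer1E_zeros hs hB hD hg₁ hgen₁ Q hQg with ⟨hg, hh2, hh3⟩ | ⟨hg, hh2, hh3⟩ | ⟨hg, hh2, hh3⟩ |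
    ⟨hg, hh2, hh3⟩
  · left
    have he : e = 1 := hdvd (by rw [hh2]; exact dvd_zero _)
    rw [he, hg, hh3]; exact ⟨by norm_num, dvd_zero _⟩
  · left
    have he : e = 2 := hcop (by rw [hh2]; exact isCoprime_one_left)
    rw [he, hg, hh3]; exact ⟨by norm_num, by norm_num⟩
  · left
    have he : e = 2 := hcop (by rw [hh2]; exact isCoprime_one_left)
    rw [he, hg, hh3]; exact ⟨by norm_num, dvd_zero _⟩
  · right
    have he : e = 1 := hdvd (by rw [hh2]; exact dvd_zero _)
    rw [he, hg, hh3]; exact ⟨by norm_num, by norm_num⟩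

/-- **Layer 2, zeros of `𝔤 - 1`**: unramified, `v(𝔤 - 1) = 3`, `𝔥₃` unit. [cite: Stichtenoth2009, Prop. 3.7.3] -/
theorem layer2E_ones {s c c' b₁ b₂ b₃ d₁ d₂ : K} (hs : s ^ 2 = -11)
    (hB : 𝔅(K, s) = C c * (X - C b₁) * (X - C b₂) * (X - C b₃))
    (hD : 𝔇(K, s) = C c' * (X - C d₁) * (X - C d₂)) {g₁ : F₁}
    (hg₁ : g₁ ^ 3 = algebraMap (RatFunc K) F₁ 𝔥₁(K, d₁, d₂))
    (hgen₁ : IntermediateField.adjoin (RatFunc K) {g₁} = ⊤) {g₂ : F₂}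
    (hg₂ : g₂ ^ 2 = algebraMap F₁ F₂ (algebraMap (RatFunc K) F₁ 𝔥₂(K, b₁, b₂)))
    (hgen₂ : IntermediateField.adjoin F₁ {g₂} = ⊤) (R : PlaceOver K F₂)
    (hR : 0 < R.ord (algebraMap F₁ F₂ (algebraMap (RatFunc K) F₁ (𝔤(K, s) - 1)))) :
    R.ord (algebraMap F₁ F₂ (algebraMap (RatFunc K) F₁ (𝔤(K, s) - 1))) = 3 ∧
      ((2 : ℕ) : ℤ) ∣ R.ord (algebraMap F₁ F₂ (algebraMap (RatFunc K) F₁ 𝔥₂(K, b₁, b₃))) := by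
  haveI : IsAlgFunctionField K F₁ := isAlgFunctionField_of_finiteDimensional (K := K) (F := RatFunc K)
  haveI : IsAlgFunctionField K F₂ := isAlgFunctionField_of_finiteDimensional (K := K) (F := F₁)
  have h2K : ((2 : ℕ) : K) ≠ 0 := by norm_num
  obtain ⟨-, -, hh20⟩ := lineE_ne_zero (K := K) b₁ b₂
  have hH20 : algebraMap (RatFunc K) F₁ 𝔥₂(K, b₁, b₂) ≠ 0 := (_root_.map_ne_zero _).2 hh20
  obtain ⟨e, he1, hmul, hdvd, -⟩ := R.exists_index_of_pow_eq (K := K) (F := F₁) two_pos h2K hH20 hg₂ hgen₂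
  set Q := R.restrict (K := K) (F := F₁) with hQ'
  have hQg : 0 < Q.ord (algebraMap (RatFunc K) F₁ (𝔤(K, s) - 1)) :=
    aux_pos_of_mul he1 (by rw [← hmul]; exact hR)
  obtain ⟨hg1, hh2, hh3⟩ := layer1E_ones hs hB hD hg₁ hgen₁ Q hQg
  have he : e = 1 := hdvd (by rw [hh2]; exact dvd_zero _)
  rw [hmul, hmul, he, hg1, hh3]; exact ⟨by norm_num, dvd_zero _⟩

/-- **Layer 2, poles of the seed**: unramified (`v(𝔥₂) = -2`), `v(𝔤) = -11`, `v(𝔥₃) = -2` even.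
[cite: Stichtenoth2009, Prop. 3.7.3] -/
theorem layer2E_poles {s : K} (hs : s ^ 2 = -11) {b₁ b₂ b₃ d₁ d₂ : K} {g₁ : F₁}
    (hg₁ : g₁ ^ 3 = algebraMap (RatFunc K) F₁ 𝔥₁(K, d₁, d₂))
    (hgen₁ : IntermediateField.adjoin (RatFunc K) {g₁} = ⊤) {g₂ : F₂}
    (hg₂ : g₂ ^ 2 = algebraMap F₁ F₂ (algebraMap (RatFunc K) F₁ 𝔥₂(K, b₁, b₂)))
    (hgen₂ : IntermediateField.adjoin F₁ {g₂} = ⊤) (R : PlaceOver K F₂)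
    (hR : R.ord (algebraMap F₁ F₂ (algebraMap (RatFunc K) F₁ 𝔤(K, s))) < 0) :
    R.ord (algebraMap F₁ F₂ (algebraMap (RatFunc K) F₁ 𝔤(K, s))) = -11 ∧
      ((2 : ℕ) : ℤ) ∣ R.ord (algebraMap F₁ F₂ (algebraMap (RatFunc K) F₁ 𝔥₂(K, b₁, b₃))) := by
  haveI : IsAlgFunctionField K F₁ := isAlgFunctionField_of_finiteDimensional (K := K) (F := RatFunc K)
  haveI : IsAlgFunctionField K F₂ := isAlgFunctionField_of_finiteDimensional (K := K) (F := F₁)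
  have h2K : ((2 : ℕ) : K) ≠ 0 := by norm_num
  obtain ⟨-, -, hh20⟩ := lineE_ne_zero (K := K) b₁ b₂
  have hH20 : algebraMap (RatFunc K) F₁ 𝔥₂(K, b₁, b₂) ≠ 0 := (_root_.map_ne_zero _).2 hh20
  obtain ⟨e, he1, hmul, hdvd, -⟩ := R.exists_index_of_pow_eq (K := K) (F := F₁) two_pos h2K hH20 hg₂ hgen₂
  set Q := R.restrict (K := K) (F := F₁) with hQ'
  have hQg : Q.ord (algebraMap (RatFunc K) F₁ 𝔤(K, s)) < 0 := aux_neg_of_mul he1 (by rw [← hmul]; exact hR)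
  obtain ⟨hg, hh2, hh3⟩ := layer1E_poles hs b₁ b₂ b₃ hg₁ hgen₁ Q hQg
  have he : e = 1 := hdvd (by rw [hh2]; exact ⟨-1, by norm_num⟩)
  rw [hmul, hmul, he, hg, hh3]; exact ⟨by norm_num, ⟨-1, by norm_num⟩⟩

/-- **Layer 2, the other closed points**: unramified, `v(π₀(𝔤)) = 1`, `𝔥₃` unit.
[cite: Stichtenoth2009, Prop. 3.7.3] -/
theorem layer2E_elsewhere {s c c' b₁ b₂ b₃ d₁ d₂ : K} (hs : s ^ 2 = -11)
    (hB : 𝔅(K, s) = C c * (X - C b₁) * (X - C b₂) * (X - C b₃))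
    (hD : 𝔇(K, s) = C c' * (X - C d₁) * (X - C d₂)) {g₁ : F₁}
    (hg₁ : g₁ ^ 3 = algebraMap (RatFunc K) F₁ 𝔥₁(K, d₁, d₂))
    (hgen₁ : IntermediateField.adjoin (RatFunc K) {g₁} = ⊤) {g₂ : F₂}
    (hg₂ : g₂ ^ 2 = algebraMap F₁ F₂ (algebraMap (RatFunc K) F₁ 𝔥₂(K, b₁, b₂)))
    (hgen₂ : IntermediateField.adjoin F₁ {g₂} = ⊤) {π₀ : K[X]} (hπi : Irreducible π₀)
    (hπm : π₀.Monic) (hπX : π₀ ≠ X) (hπX1 : π₀ ≠ X - 1) (R : PlaceOver K F₂)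
    (hR : 0 < R.ord (algebraMap F₁ F₂ (algebraMap (RatFunc K) F₁ (aeval 𝔤(K, s) π₀)))) :
    R.ord (algebraMap F₁ F₂ (algebraMap (RatFunc K) F₁ (aeval 𝔤(K, s) π₀))) = 1 ∧
      ((2 : ℕ) : ℤ) ∣ R.ord (algebraMap F₁ F₂ (algebraMap (RatFunc K) F₁ 𝔥₂(K, b₁, b₃))) := by
  haveI : IsAlgFunctionField K F₁ := isAlgFunctionField_of_finiteDimensional (K := K) (F := RatFunc K)
  haveI : IsAlgFunctionField K F₂ := isAlgFunctionField_of_finiteDimensional (K := K) (F := F₁)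
  have h2K : ((2 : ℕ) : K) ≠ 0 := by norm_num
  obtain ⟨-, -, hh20⟩ := lineE_ne_zero (K := K) b₁ b₂
  have hH20 : algebraMap (RatFunc K) F₁ 𝔥₂(K, b₁, b₂) ≠ 0 := (_root_.map_ne_zero _).2 hh20
  obtain ⟨e, he1, hmul, hdvd, -⟩ := R.exists_index_of_pow_eq (K := K) (F := F₁) two_pos h2K hH20 hg₂ hgen₂
  set Q := R.restrict (K := K) (F := F₁) with hQ'
  have hQg : 0 < Q.ord (algebraMap (RatFunc K) F₁ (aeval 𝔤(K, s) π₀)) :=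
    aux_pos_of_mul he1 (by rw [← hmul]; exact hR)
  obtain ⟨h1, hh2, hh3⟩ := layer1E_elsewhere hs hB hD hg₁ hgen₁ hπi hπm hπX hπX1 Q hQg
  have he : e = 1 := hdvd (by rw [hh2]; exact dvd_zero _)
  rw [hmul, hmul, he, h1, hh3]; exact ⟨by norm_num, dvd_zero _⟩

end Layer2

/-! ### F. The third layer and the covering of signature `(2, 3, 11)` -/

section Cover

/-- **Three Kummer layers over Klein's resolvent: a covering of signature `(2, 3, 11)`** over (the full
constant field inside `F₃` of) any number field `K` containing `s = √-11` over which `𝔅` and `𝔇` split,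
`𝔅 = c (X - b₁)(X - b₂)(X - b₃)`, `𝔇 = c' (X - d₁)(X - d₂)`: `F₁ = K(v)(g₁)`, `g₁³ = (v - d₁)(v - d₂)²`;
`F₂ = F₁(g₂)`, `g₂² = (v - b₁)(v - b₂)`; `F₃ = F₂(g₃)`, `g₃² = (v - b₁)(v - b₃)`; and
`f = -𝔅(v) 𝔄(v)²/13824 = 1 - J(v)`. Degree `132 = 11 · 12`, genus `6` (Riemann–Hurwitz).
[cite: Stichtenoth2009, Prop. 3.7.3] [cite: DarmonGranville1995, Prop. 3.1 (p. 525), signature `(2, 3, 11)`] -/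
theorem exists_belyiMap_signature_two_three_eleven_aux (K : Type u) [Field K] [NumberField K]
    {s c c' b₁ b₂ b₃ d₁ d₂ : K} (hs : s ^ 2 = -11)
    (hB : 𝔅(K, s) = C c * (X - C b₁) * (X - C b₂) * (X - C b₃))
    (hD : 𝔇(K, s) = C c' * (X - C d₁) * (X - C d₂)) :
    ∃ (K' : Type u) (_ : Field K') (_ : NumberField K') (F : Type u) (_ : Field F) (_ : Algebra K' F)
      (_ : IsAlgFunctionField K' F) (_ : IsIntegrallyClosedIn K' F) (f : F),
      f ∉ Set.range (algebraMap K' F) ∧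
      (∀ P : PlaceOver K' F, 0 < P.ord f → P.ord f = 2) ∧
      (∀ P : PlaceOver K' F, 0 < P.ord (f - 1) → P.ord (f - 1) = 3) ∧
      (∀ P : PlaceOver K' F, P.ord f < 0 → P.ord f = -11) ∧
      (∀ π₀ : K'[X], Irreducible π₀ → π₀.Monic → π₀ ≠ X → π₀ ≠ X - 1 →
        ∀ P : PlaceOver K' F, 0 < P.ord (aeval f π₀) → P.ord (aeval f π₀) = 1) := by
  haveI : CharZero (RatFunc K) :=
    charZero_of_injective_algebraMap (algebraMap K (RatFunc K)).injective
  have h2K : ((2 : ℕ) : K) ≠ 0 := by norm_num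
  obtain ⟨-, -, hh30⟩ := lineE_ne_zero (K := K) b₁ b₃
  -- layer 1 (cubic)
  obtain ⟨F₁, _, _, _, _, _, _, g₁, hg₁, hgen₁⟩ := exists_radical_extension (K := K) (F := RatFunc K)
    𝔥₁(K, d₁, d₂) (by norm_num : 0 < 3)
  haveI hAF₁ : IsAlgFunctionField K F₁ :=
    isAlgFunctionField_of_finiteDimensional (K := K) (F := RatFunc K)
  haveI : CharZero F₁ := charZero_of_injective_algebraMap (algebraMap K F₁).injective
  -- layer 2 (quadratic)
  obtain ⟨F₂, _, _, _, _, _, _, g₂, hg₂, hgen₂⟩ := exists_radical_extension (K := K) (F := F₁)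
    (algebraMap (RatFunc K) F₁ 𝔥₂(K, b₁, b₂)) two_pos
  haveI hAF₂ : IsAlgFunctionField K F₂ := isAlgFunctionField_of_finiteDimensional (K := K) (F := F₁)
  haveI : CharZero F₂ := charZero_of_injective_algebraMap (algebraMap K F₂).injective
  -- layer 3 (quadratic)
  set H₃ : F₂ := algebraMap F₁ F₂ (algebraMap (RatFunc K) F₁ 𝔥₂(K, b₁, b₃)) with hH₃
  have hH₃0 : H₃ ≠ 0 := (_root_.map_ne_zero _).2 ((_root_.map_ne_zero _).2 hh30)
  obtain ⟨F₃, _, _, _, _, _, _, g₃, hg₃, hgen₃⟩ := exists_radical_extension (K := K) (F := F₂) H₃ two_pos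
  haveI hAF₃ : IsAlgFunctionField K F₃ := isAlgFunctionField_of_finiteDimensional (K := K) (F := F₂)
  -- the function
  set f₁ : F₁ := algebraMap (RatFunc K) F₁ 𝔤(K, s) with hf₁
  set f₂ : F₂ := algebraMap F₁ F₂ f₁ with hf₂
  set f : F₃ := algebraMap F₂ F₃ f₂ with hf
  have hf₁t : Transcendental K f₁ :=
    (transcendental_algebraMap_iff (algebraMap (RatFunc K) F₁).injective).2 (seedE_transcendental s).2.1
  have hf₂t : Transcendental K f₂ := (transcendental_algebraMap_iff (algebraMap F₁ F₂).injective).2 hf₁t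
  have hft : Transcendental K f := (transcendental_algebraMap_iff (algebraMap F₂ F₃).injective).2 hf₂t
  -- the four clauses over `K`
  have h₀ : ∀ R : PlaceOver K F₃, 0 < R.ord f → R.ord f = 2 := fun R hR =>
    PlaceOver.ord_algebraMap_eq_of_forall_ord_pos_mixed (K := K) (F := F₂) (F' := F₃) two_pos h2K hH₃0 hg₃
      hgen₃ (fun Q hQ => layer2E_zeros hs hB hD hg₁ hgen₁ hg₂ hgen₂ Q hQ) R hR
  have hi : ∀ R : PlaceOver K F₃, R.ord f < 0 → R.ord f = -11 := fun R hR =>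
    PlaceOver.ord_algebraMap_eq_of_forall_ord_neg_of_dvd (K := K) (F := F₂) (F' := F₃) two_pos h2K hH₃0
      hg₃ hgen₃ (p₀ := 11) (fun Q hQ => layer2E_poles hs hg₁ hgen₁ hg₂ hgen₂ Q hQ) R hR
  have h₁ : ∀ R : PlaceOver K F₃, 0 < R.ord (f - 1) → R.ord (f - 1) = 3 := by
    intro R hR
    have heq : f - 1 = algebraMap F₂ F₃ (algebraMap F₁ F₂ (algebraMap (RatFunc K) F₁ (𝔤(K, s) - 1))) := by
      simp only [hf, hf₂, hf₁, map_sub, map_one]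
    rw [heq] at hR ⊢
    exact PlaceOver.ord_algebraMap_eq_of_forall_ord_pos_of_dvd (K := K) (F := F₂) (F' := F₃) two_pos h2K
      hH₃0 hg₃ hgen₃ (fun Q hQ => layer2E_ones hs hB hD hg₁ hgen₁ hg₂ hgen₂ Q hQ) R hR
  have hunr : ∀ π₀ : K[X], Irreducible π₀ → π₀.Monic → π₀ ≠ X → π₀ ≠ X - 1 →
      ∀ R : PlaceOver K F₃, 0 < R.ord (aeval f π₀) → R.ord (aeval f π₀) = 1 := by
    intro π₀ hπi hπm hX hX1 R hR
    have heq : aeval f π₀ =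
        algebraMap F₂ F₃ (algebraMap F₁ F₂ (algebraMap (RatFunc K) F₁ (aeval 𝔤(K, s) π₀))) := by
      rw [hf, hf₂, hf₁, aeval_algebraMap_apply, aeval_algebraMap_apply, aeval_algebraMap_apply]
    rw [heq] at hR ⊢
    exact PlaceOver.ord_algebraMap_eq_of_forall_ord_pos_of_dvd (K := K) (F := F₂) (F' := F₃) two_pos h2K
      hH₃0 hg₃ hgen₃ (fun Q hQ => layer2E_elsewhere hs hB hD hg₁ hgen₁ hg₂ hgen₂ hπi hπm hX hX1 Q hQ) R hR
  -- pass to the full constant field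
  obtain ⟨K', _, _, _, _, _, hfK', h₀', h₁', hi', hunr'⟩ :=
    exists_fullConstantField_of_signature (K := K) (F := F₃) hft h₀ h₁ hi hunr
  exact ⟨K', inferInstance, inferInstance, F₃, inferInstance, inferInstance, inferInstance,
    inferInstance, f, hfK', h₀', h₁', hi', hunr'⟩

/-- **`𝔅` and `𝔇` divide their norms to `ℚ[X]`**: `𝔅 · 𝔅̄ = N(𝔅)`, `𝔇 · 𝔇̄ = N(𝔇)` with
`N(𝔅) = 4 X⁶ - 32 X⁵ + 92 X⁴ - 144 X³ + 452 X² - 1432 X + 1648`, `N(𝔇) = X⁴ + 6 X³ + 19 X² + 30 X + 36`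
(`𝔅̄`, `𝔇̄`: `s ↦ -s`). [folklore] -/
theorem formsE_norm {K : Type u} [Field K] {s : K} (hs : s ^ 2 = -11) :
    𝔅(K, s) * ((2 : K[X]) * X ^ 3 - (8 : K[X]) * X ^ 2 + (5 : K[X]) * C s * X + (7 : K[X]) * X - (12 : K[X]) * C s -
      (8 : K[X])) = (4 : K[X]) * X ^ 6 - (32 : K[X]) * X ^ 5 + (92 : K[X]) * X ^ 4 - (144 : K[X]) * X ^ 3 +
      (452 : K[X]) * X ^ 2 - (1432 : K[X]) * X + (1648 : K[X]) ∧
    𝔇(K, s) * ((X : K[X]) ^ 2 + (3 : K[X]) * X + C s + (5 : K[X])) =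
      (X : K[X]) ^ 4 + (6 : K[X]) * X ^ 3 + (19 : K[X]) * X ^ 2 + (30 : K[X]) * X + (36 : K[X]) := by
  constructor
  · linear_combination (-(25 : K[X]) * X ^ 2 + (120 : K[X]) * X - (144 : K[X])) * C_sq_eq s hs
  · linear_combination (-(1 : K[X])) * C_sq_eq s hs

/-- **A covering of signature `(2, 3, 11)` over a number field**, in the shape of the covering input of
`finite_properSolutions_of_belyiMap_of_faltings`: the construction over the splitting field of
`(X² + 11) · N(𝔅) · N(𝔇)` over `ℚ`. It has degree `132` and genus `6` (the degree and genus of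
`X(11)/C₅ → X(1)`) and is obtained as three Kummer layers of degrees `3, 2, 2` over Klein's resolvent
`X(11)/A₅ → X(1)` of degree `11`; no Riemann existence theorem is used.
[cite: Klein1879Elf] [cite: FrickeElliptische2, II.5 §7 (15), p. 490]
[cite: Stichtenoth2009, Prop. 3.7.3] [cite: DarmonGranville1995, Prop. 3.1 (p. 525), signature `(2, 3, 11)`] -/
theorem exists_belyiMap_signature_two_three_eleven :
    ∃ (K : Type) (_ : Field K) (_ : NumberField K) (F : Type) (_ : Field F) (_ : Algebra K F)
      (_ : IsAlgFunctionField K F) (_ : IsIntegrallyClosedIn K F) (f : F),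
      f ∉ Set.range (algebraMap K F) ∧
      (∀ P : PlaceOver K F, 0 < P.ord f → P.ord f = 2) ∧
      (∀ P : PlaceOver K F, 0 < P.ord (f - 1) → P.ord (f - 1) = 3) ∧
      (∀ P : PlaceOver K F, P.ord f < 0 → P.ord f = -11) ∧
      (∀ π₀ : K[X], Irreducible π₀ → π₀.Monic → π₀ ≠ X → π₀ ≠ X - 1 →
        ∀ P : PlaceOver K F, 0 < P.ord (aeval f π₀) → P.ord (aeval f π₀) = 1) := by
  -- the number field: the splitting field of `(X² + 11) N(𝔅) N(𝔇)` over `ℚ`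
  set NB : ℚ[X] := (4 : ℚ[X]) * X ^ 6 - (32 : ℚ[X]) * X ^ 5 + (92 : ℚ[X]) * X ^ 4 - (144 : ℚ[X]) * X ^ 3 +
    (452 : ℚ[X]) * X ^ 2 - (1432 : ℚ[X]) * X + (1648 : ℚ[X]) with hNB
  set ND : ℚ[X] := (X : ℚ[X]) ^ 4 + (6 : ℚ[X]) * X ^ 3 + (19 : ℚ[X]) * X ^ 2 + (30 : ℚ[X]) * X + (36 : ℚ[X])
    with hND
  set q : ℚ[X] := ((X : ℚ[X]) ^ 2 + 11) * NB * ND with hq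
  have hq0 : q ≠ 0 := fun h => by
    have h' := congr_arg (Polynomial.eval 0) h
    rw [hq, hNB, hND] at h'
    norm_num at h'
  let K := q.SplittingField
  haveI : CharZero K := charZero_of_injective_algebraMap (algebraMap ℚ K).injective
  haveI : NumberField K := { to_charZero := inferInstance, to_finiteDimensional := inferInstance }
  have hsplit : (q.map (algebraMap ℚ K)).Splits := SplittingField.splits q
  have hqK0 : q.map (algebraMap ℚ K) ≠ 0 := Polynomial.map_ne_zero hq0
  -- `s = √-11`
  have hsS : (((X : ℚ[X]) ^ 2 + 11).map (algebraMap ℚ K)).Splits :=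
    hsplit.of_dvd hqK0 (Polynomial.map_dvd _ ⟨NB * ND, by rw [hq]; ring⟩)
  have hS : ((X : ℚ[X]) ^ 2 + 11).map (algebraMap ℚ K) = (X : K[X]) ^ 2 + 11 := by
    simp only [Polynomial.map_add, Polynomial.map_pow, map_X, Polynomial.map_ofNat]
  rw [hS] at hsS
  have hS0 : ((X : K[X]) ^ 2 + 11) ≠ 0 := fun h => by
    have h' := congr_arg (Polynomial.eval 0) h
    norm_num at h'
  have hcard : ((X : K[X]) ^ 2 + 11).roots.card = 2 := by
    rw [← hsS.natDegree_eq_card_roots]; compute_degree!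
  obtain ⟨s, hsmem⟩ := Multiset.card_pos_iff_exists_mem.1 (by rw [hcard]; norm_num)
  have hs : s ^ 2 = -11 := by
    have h := (mem_roots hS0).1 hsmem
    rw [IsRoot.def, eval_add, eval_pow, eval_X] at h
    norm_num at h
    linear_combination h
  -- `𝔅` splits
  have hNBS : (NB.map (algebraMap ℚ K)).Splits :=
    hsplit.of_dvd hqK0 (Polynomial.map_dvd _ ⟨((X : ℚ[X]) ^ 2 + 11) * ND, by rw [hq]; ring⟩)
  have hNBK : NB.map (algebraMap ℚ K) = (4 : K[X]) * X ^ 6 - (32 : K[X]) * X ^ 5 + (92 : K[X]) * X ^ 4 -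
      (144 : K[X]) * X ^ 3 + (452 : K[X]) * X ^ 2 - (1432 : K[X]) * X + (1648 : K[X]) := by
    rw [hNB]
    simp only [Polynomial.map_add, Polynomial.map_sub, Polynomial.map_mul, Polynomial.map_pow, map_X,
      Polynomial.map_ofNat]
  rw [hNBK] at hNBS
  have hNB0 : ((4 : K[X]) * X ^ 6 - (32 : K[X]) * X ^ 5 + (92 : K[X]) * X ^ 4 - (144 : K[X]) * X ^ 3 +
      (452 : K[X]) * X ^ 2 - (1432 : K[X]) * X + (1648 : K[X])) ≠ 0 := fun h => by
    have h' := congr_arg (Polynomial.eval 0) h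
    norm_num at h'
  obtain ⟨hfB, hfD⟩ := formsE_norm (K := K) hs
  have hBS : (𝔅(K, s)).Splits := hNBS.of_dvd hNB0 (Dvd.intro _ hfB)
  obtain ⟨-, hdB, -, hdD⟩ := natDegree_formsE (K := K) s
  have hcardB : (𝔅(K, s)).roots.card = 3 := by rw [← hBS.natDegree_eq_card_roots, hdB]
  obtain ⟨b₁, b₂, b₃, hrootsB⟩ := Multiset.card_eq_three.1 hcardB
  have hB := hBS.eq_prod_roots
  rw [hrootsB] at hB
  simp only [Multiset.insert_eq_cons, Multiset.map_cons, Multiset.map_singleton, Multiset.prod_cons,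
    Multiset.prod_singleton] at hB
  have hB' : 𝔅(K, s) = C (𝔅(K, s)).leadingCoeff * (X - C b₁) * (X - C b₂) * (X - C b₃) := by
    conv_lhs => rw [hB]
    ring
  -- `𝔇` splits
  have hNDS : (ND.map (algebraMap ℚ K)).Splits :=
    hsplit.of_dvd hqK0 (Polynomial.map_dvd _ ⟨((X : ℚ[X]) ^ 2 + 11) * NB, by rw [hq]; ring⟩)
  have hNDK : ND.map (algebraMap ℚ K) =
      (X : K[X]) ^ 4 + (6 : K[X]) * X ^ 3 + (19 : K[X]) * X ^ 2 + (30 : K[X]) * X + (36 : K[X]) := by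
    rw [hND]
    simp only [Polynomial.map_add, Polynomial.map_mul, Polynomial.map_pow, map_X, Polynomial.map_ofNat]
  rw [hNDK] at hNDS
  have hND0 : ((X : K[X]) ^ 4 + (6 : K[X]) * X ^ 3 + (19 : K[X]) * X ^ 2 + (30 : K[X]) * X + (36 : K[X])) ≠ 0 :=
    fun h => by
    have h' := congr_arg (Polynomial.eval 0) h
    norm_num at h'
  have hDS : (𝔇(K, s)).Splits := hNDS.of_dvd hND0 (Dvd.intro _ hfD)
  have hcardD : (𝔇(K, s)).roots.card = 2 := by rw [← hDS.natDegree_eq_card_roots, hdD]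
  obtain ⟨d₁, d₂, hrootsD⟩ := Multiset.card_eq_two.1 hcardD
  have hD := hDS.eq_prod_roots
  rw [hrootsD] at hD
  simp only [Multiset.insert_eq_cons, Multiset.map_cons, Multiset.map_singleton, Multiset.prod_cons,
    Multiset.prod_singleton] at hD
  have hD' : 𝔇(K, s) = C (𝔇(K, s)).leadingCoeff * (X - C d₁) * (X - C d₂) := by
    conv_lhs => rw [hD]
    ring
  exact exists_belyiMap_signature_two_three_eleven_aux K hs hB' hD'

end Cover

end AlgFunctionField

/-! ### G. Darmon–Granville for the signatures `(p, q, r)` with `2 ∣ p`, `3 ∣ q`, `11 ∣ r`, modulo Faltings -/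

section DarmonGranville

open AlgFunctionField

/-- **`A x^p + B y^q = C z^r` has finitely many proper solutions whenever `2 ∣ p`, `3 ∣ q`, `11 ∣ r`
(`p q r ≠ 0`), modulo Faltings' theorem** (`finite_ratPlaces_of_two_le_genus`): the covering
`exists_belyiMap_signature_two_three_eleven` fed into `finite_properSolutions_of_belyiMap_of_faltings`
gives `(2, 3, 11)` (hyperbolic: `1/2 + 1/3 + 1/11 = 61/66`), and `finite_properSolutions_of_dvd` the
multiples. No Riemann existence theorem is used. [cite: DarmonGranville1995, Theorem 2 (p. 515)] -/
theorem finite_properSolutions_signature_two_three_eleven_of_faltings {p q r : ℕ}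
    (hp : 2 ∣ p) (hq : 3 ∣ q) (hr : 11 ∣ r) (hp0 : p ≠ 0) (hq0 : q ≠ 0) (hr0 : r ≠ 0)
    (hFaltings : ∀ (K' : Type) [Field K'] (F' : Type) [Field F'] [Algebra K' F'],
      finite_ratPlaces_of_two_le_genus K' F')
    {A B C : ℤ} (hA : A ≠ 0) (hB : B ≠ 0) (hC : C ≠ 0) :
    {t : ℤ × ℤ × ℤ | ({t.1, t.2.1, t.2.2} : Finset ℤ).gcd id = 1 ∧
      A * t.1 ^ p + B * t.2.1 ^ q = C * t.2.2 ^ r}.Finite := by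
  obtain ⟨K, _, _, F, _, _, _, _, f, hf, h₀, h₁, hi, hunr⟩ := exists_belyiMap_signature_two_three_eleven
  have hhyp : 3 * 11 + 11 * 2 + 2 * 3 < 2 * 3 * 11 := by norm_num
  exact finite_properSolutions_of_dvd hp hq hr hp0 hq0 hr0
    (finite_properSolutions_of_belyiMap_of_faltings hhyp hf h₀ h₁ (by exact_mod_cast hi) hunr hFaltings
      hA hB hC)

/-- **`A x^r + B y² = C z³` has finitely many proper solutions for every `r ≠ 0` divisible by `11`,
modulo Faltings' theorem only** — in particular for `r = 11`, `121`, `1331`, whose triangle groups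
`Δ(2, 3, r)` are perfect. [cite: DarmonGranville1995, Theorem 2 (p. 515)] -/
theorem finite_properSolutions_signature_eleven_two_three_of_faltings {r : ℕ} (hr0 : r ≠ 0) (h11 : 11 ∣ r)
    (hFaltings : ∀ (K' : Type) [Field K'] (F' : Type) [Field F'] [Algebra K' F'],
      finite_ratPlaces_of_two_le_genus K' F')
    {A B C : ℤ} (hA : A ≠ 0) (hB : B ≠ 0) (hC : C ≠ 0) :
    {t : ℤ × ℤ × ℤ | ({t.1, t.2.1, t.2.2} : Finset ℤ).gcd id = 1 ∧
      A * t.1 ^ r + B * t.2.1 ^ 2 = C * t.2.2 ^ 3}.Finite := by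
  have h23 : ∀ A B C : ℤ, A ≠ 0 → B ≠ 0 → C ≠ 0 →
      {t : ℤ × ℤ × ℤ | ({t.1, t.2.1, t.2.2} : Finset ℤ).gcd id = 1 ∧
        A * t.1 ^ 2 + B * t.2.1 ^ 3 = C * t.2.2 ^ r}.Finite := fun A B C hA hB hC =>
    finite_properSolutions_signature_two_three_eleven_of_faltings dvd_rfl dvd_rfl h11 two_ne_zero
      three_ne_zero hr0 hFaltings hA hB hC
  exact forall_finite_properSolutions_swap₁₂ (forall_finite_properSolutions_swap₂₃ h23) A B C hA hB hC

/-- **`A x^r + B y² = C z³` has finitely many proper solutions for every `r ≥ 7` with a prime factor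
`≤ 13`** (`2 ∣ r`, `3 ∣ r`, `5 ∣ r`, `7 ∣ r`, `11 ∣ r` or `13 ∣ r`), modulo Faltings' theorem only — the
union of the dihedral, tetrahedral, icosahedral, level-`7`, level-`11` and level-`13` constructions. The
remaining `r` (prime to `30030`) are those all of whose prime factors are `≥ 17`; they are not treated
(no rational modular seed of genus `0` is available; they would need the modular curves `X(p)` of positive
genus or the Riemann existence theorem). [cite: DarmonGranville1995, Theorem 2 (p. 515)] -/
theorem finite_properSolutions_signature_r_two_three_of_faltings_of_dvd_le_thirteen {r : ℕ}
    (hr : 7 ≤ r) (h : 2 ∣ r ∨ 3 ∣ r ∨ 5 ∣ r ∨ 7 ∣ r ∨ 11 ∣ r ∨ 13 ∣ r)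
    (hFaltings : ∀ (K' : Type) [Field K'] (F' : Type) [Field F'] [Algebra K' F'],
      finite_ratPlaces_of_two_le_genus K' F')
    {A B C : ℤ} (hA : A ≠ 0) (hB : B ≠ 0) (hC : C ≠ 0) :
    {t : ℤ × ℤ × ℤ | ({t.1, t.2.1, t.2.2} : Finset ℤ).gcd id = 1 ∧
      A * t.1 ^ r + B * t.2.1 ^ 2 = C * t.2.2 ^ 3}.Finite := by
  by_cases h11 : 11 ∣ r
  · exact finite_properSolutions_signature_eleven_two_three_of_faltings (by omega) h11 hFaltings hA hB hC
  · have h' : 2 ∣ r ∨ 3 ∣ r ∨ 5 ∣ r ∨ 7 ∣ r ∨ 13 ∣ r := by tauto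
    exact finite_properSolutions_signature_r_two_three_of_faltings_of_dvd hr h' hFaltings hA hB hC

end DarmonGranville

end Literature.NumberTheory.DiophantineGeometry
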